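import Literature.Computability.Complexity.StackHarveySearchScan
import Literature.Computability.Complexity.StackIsqrt
import HarnessLib

/-!
# Trial division and the per-number procedure of the factoring machine

Literature / complexity toolkit, continuing `StackHarveySearchScan.lean` (Harvey's Algorithm 2 on the
stack machine) and `StackBaseSearch.lean` (the base search = small prime factors / an element of
large order).  This file assembles, on the stack register machine, the two number-theoretic
procedures of the deterministic `N^{1/5+o(1)}` factoring machine (D. Harvey, arXiv:2010.05450,
§4 and the proof of Thm. 1):

* **trial division** (`tdiv`, **`runs_tdiv`**, specified by the fold `tdRun`): division of the
  cofactor on `MN0` by `t = 2, 3, …, T + 1`, `|enc N|` division rounds per divisor, the divisors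
  found emitted in increasing order with multiplicity onto `MNF`;
* **the per-number procedure** `core` (**`runs_core`**, outcome `coreOut X B : Option ℕ`) for an odd
  `X > 1` on `MN0` (all prime factors above the number of bases `B`): stage 1, the base search with
  `e₁ = ⌈|enc X|/6⌉` (a factor, or no prime factor `≤ 4^{e₁}`, `(4^{e₁})³ > X`); stage 2, the
  square test (`⌊√X⌋`, `StackIsqrt`); stage 3, the base search with `e₂` (`4^{e₂}·4^{e₂}·r > X`,
  `r = m = 2^{⌊|enc X|/5⌋}`); stages 4–5, the order search with `e₃` (`4^{e₃} ≥ m`,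
  `LB = 2^{⌊3|enc X|/10⌋+2}`, `M = ⌊√X⌋`) followed, when it stops clear at a base `α`, by Harvey's
  Algorithm 2 with `(α, m, r)`; each stage runs only while no factor is known (`gd`, the register
  `MNP`).  The modulus `MD` and the constant `CINV = (X+1)/2` of the multiplier are ambient
  registers below the machine's variables; this file supplies their write lemmas
  (`update_hSt_MD`, `update_hSt_CINV`, `drvInv_setMod`).

The arithmetic meaning of `coreOut` (a reported value is a proper divisor; "none" means prime under
the invariants of the main driver) is proved in the sequel.  All control is by flag-guarded
fixed-count loops; every theorem is proved, no named facts.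

## References

* D. Harvey, *An exponent one-fifth algorithm for deterministic integer factorisation*,
  Math. Comp. 90 (2021) 2937–2950, §4 (Algorithm 3, Prop. 4.3) and the proof of Thm. 1.1
  (arXiv:2010.05450, Algorithm 3, Prop. 16, proof of Thm. 1). [Harvey2021]
* R. Crandall, C. Pomerance, *Prime Numbers: A Computational Perspective*, 2nd ed., Springer 2005,
  §3.1.1 (trial division). (Folklore material, fully proved here.)
-/

namespace Literature.Computability.Complexity

open _root_.Computability SProg

namespace Com

variable {β : Type} [DecidableEq β] (h : HReg ↪ β)

section TrialDivision

/-! ### Trial division on the machine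

`MN0 = X` (the cofactor), `MNB = t` (the trial divisor), `MNF` the reversed accumulator of the
divisors found (in increasing order, with multiplicity), `MNC = 1^{nb}` the number of division
rounds per divisor, `U1`/`U2` the counters. -/

/-- One division round: if `t ∣ X` then `X := X / t` and `t` is emitted. [folklore] -/
def tdStep (t : ℕ) (s : ℕ × List ℕ) : ℕ × List ℕ := if s.1 % t = 0 then (s.1 / t, s.2 ++ [t]) else s

/-- The rounds of one divisor. [folklore] -/
def tdRounds (t : ℕ) : ℕ → ℕ × List ℕ → ℕ × List ℕ
  | 0, s => s
  | i + 1, s => tdRounds t i (tdStep t s)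

/-- The state after the divisors `2, …, j + 1`. [folklore] -/
def tdRun (N nb : ℕ) : ℕ → ℕ × List ℕ
  | 0 => (N, [])
  | j + 1 => tdRounds (j + 2) nb (tdRun N nb j)

/-- The division test and update: `FL1 := [t ∣ X]`, and then `X := X / t`. [folklore] -/
def tdTest : NS β :=
  NS.seq (NS.ofList [.divMod (h .X4) (h .X5) (h .MN0) (h .MNB), .eq (h .FL2) (h .X5) (h .X6) (h .X3)])
    (NS.ite (h .FL2) (NS.ofList [.clear (h .X5), .clear (h .MN0), .move (h .X4) (h .MN0), .const (h .FL1) [true]]) (NS.ofList [.clear (h .X4), .clear (h .X5)]))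

/-- The emission of the divisor. [folklore] -/
def tdEmit : Com (EReg ⊕ β) := ((NS.op (.copy (h .MNB) (h .X5))) : NS β).com ;; emit (Sum.inr (h .X5)) (Sum.inr (h .MNF))

/-- One division round. [folklore] -/
def tdInner : Com (EReg ⊕ β) := (tdTest h).com ;; Com.pop (Sum.inr (h .FL1)) (tdEmit h) skip skip

/-- One divisor: `nb` division rounds, then `t := t + 1`. [folklore] -/
def tdOuter : Com (EReg ⊕ β) :=
  ((NS.op (.copy (h .MNC) (h .U1))) : NS β).com ;; (countLoop (Sum.inr (h .U1)) (tdInner h) ;;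
    ((NS.ofList [.succ (h .X4) (h .MNB), .clear (h .MNB), .move (h .X4) (h .MNB)] : NS β).com))

/-- Trial division by `2, …, T + 1` (`U2 = 1^T`), from `t = 2`. [folklore] -/
def tdiv : Com (EReg ⊕ β) :=
  ((NS.op (.const (h .MNB) (encodeNat 2))) : NS β).com ;; (countLoop (Sum.inr (h .U2)) (tdOuter h) ;; ((NS.op (.clear (h .MNB))) : NS β).com)

/-- `tdStep` keeps `X ≤ N`-type bounds and emits only `t`. [folklore] -/
theorem tdStep_facts (t : ℕ) (s : ℕ × List ℕ) : (tdStep t s).1 ≤ s.1 ∧ (∀ x ∈ (tdStep t s).2, x ∈ s.2 ∨ x = t) ∧ (tdStep t s).2.length ≤ s.2.length + 1 := by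
  unfold tdStep
  split_ifs with hd
  · refine ⟨Nat.div_le_self _ _, fun x hx => ?_, by simp⟩
    simp only [List.mem_append, List.mem_singleton] at hx; exact hx
  · exact ⟨le_rfl, fun x hx => Or.inl hx, by simp⟩

/-- `tdRounds` keeps the bounds. [folklore] -/
theorem tdRounds_facts (t : ℕ) : ∀ (i : ℕ) (s : ℕ × List ℕ), (tdRounds t i s).1 ≤ s.1 ∧ (∀ x ∈ (tdRounds t i s).2, x ∈ s.2 ∨ x = t) ∧ (tdRounds t i s).2.length ≤ s.2.length + i
  | 0, s => ⟨le_rfl, fun x hx => Or.inl hx, by simp [tdRounds]⟩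
  | i + 1, s => by
    obtain ⟨h1, h2, h3⟩ := tdRounds_facts t i (tdStep t s)
    obtain ⟨g1, g2, g3⟩ := tdStep_facts t s
    refine ⟨h1.trans g1, fun x hx => ?_, by simp only [tdRounds]; omega⟩
    rcases h2 x hx with hx | hx
    · exact g2 x hx
    · exact Or.inr hx

/-- `tdRun` keeps the bounds: `X ≤ N`, the divisors emitted are `≤ j + 1`, at most `j · nb` of them. [folklore] -/
theorem tdRun_facts (N nb : ℕ) : ∀ j, (tdRun N nb j).1 ≤ N ∧ (∀ x ∈ (tdRun N nb j).2, 2 ≤ x ∧ x ≤ j + 1) ∧ (tdRun N nb j).2.length ≤ j * nb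
  | 0 => by simp [tdRun]
  | j + 1 => by
    obtain ⟨h1, h2, h3⟩ := tdRun_facts N nb j
    obtain ⟨g1, g2, g3⟩ := tdRounds_facts (j + 2) nb (tdRun N nb j)
    refine ⟨g1.trans h1, fun x hx => ?_, by simp only [tdRun]; rw [Nat.succ_mul]; omega⟩
    rcases g2 x hx with hx | hx
    · have := h2 x hx; omega
    · omega

/-- **One division round.** [folklore] -/
theorem runs_tdInner {N n t : ℕ} (hn : (encodeNat N).length + 1 ≤ n) (T : Regs β) (u : HSlots) (s : ℕ × List ℕ)
    (hX : s.1 ≤ N) (ht1 : 1 ≤ t) (htn : (encodeNat t).length ≤ n)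
    (hmn0 : u.mn0 = encodeNat s.1) (hmnb : u.mnb = encodeNat t) (hmnf : u.mnf = outRev (s.2.map encodeNat))
    (hx3 : u.x3 = []) (hx4 : u.x4 = []) (hx5 : u.x5 = []) (hx6 : u.x6 = []) (hfl1 : u.fl1 = []) (hfl2 : u.fl2 = []) :
    Runs (tdInner h) (base (hSt h T u)) (base (hSt h T { u with mn0 := encodeNat (tdStep t s).1, mnf := outRev ((tdStep t s).2.map encodeNat) })) (502 * (n + 1) ^ 3 + 4 * n + 6) := by
  set c := (n + 1) ^ 3 with hc3
  have hn1 : 1 ≤ n := by omega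
  have e0 : encodeNat 0 = [] := rfl
  have hlX : (encodeNat s.1).length ≤ n := (Brick.length_encodeNat_mono hX).trans (by omega)
  have hlq : (encodeNat (s.1 / t)).length ≤ n := (Brick.length_encodeNat_mono (Nat.div_le_self _ _)).trans hlX
  have hlr : (encodeNat (s.1 % t)).length ≤ n := (Brick.length_encodeNat_mono ((Nat.mod_lt _ (by omega)).le)).trans htn
  by_cases hd : s.1 % t = 0
  · -- divisible: `X := X / t`, emit `t`
    let u1 : HSlots := { u with mn0 := encodeNat (s.1 / t), fl1 := [true] }
    have h1 : Runs (tdTest h).com (base (hSt h T u)) (base (hSt h T u1)) (489 * c) := by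
      refine NS.runs_of_eq (N := n) _ _ ?_ ?_ (by simp [tdTest, hc3])
      · simp (config := { decide := true }) only [tdTest, NS.ofList, NS.ok, NOp.ok, NS.eval, NOp.eval, hSt_X4, hSt_X5, hSt_MN0, hSt_MNB, hSt_FL2, hSt_X6, hSt_X3, hSt_FL1,
          update_hSt_X4, update_hSt_X5, update_hSt_FL2, update_hSt_MN0, hmn0, hmnb, hx3, hx4, hx5, hx6, hfl1, hfl2, hd, bitsToNat_encodeNat, bitsToNat_nil,
          ne_eq, EmbeddingLike.apply_eq_iff_eq, not_false_eq_true, List.length_nil, zero_le, and_self, hlX, htn, hlq, decide_true, flag_true, true_and, and_true,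
          List.length_cons, e0, zero_add, hn1, or_false]
        omega
      · simp [tdTest, u1, hmn0, hmnb, hx3, hx4, hx5, hx6, hfl1, hfl2, hd, e0]
    let u2 : HSlots := { u1 with fl1 := [], x5 := encodeNat t }
    have h2 : Runs ((NS.op (.copy (h .MNB) (h .X5)) : NS β).com) (base (hSt h T { u1 with fl1 := [] })) (base (hSt h T u2)) (13 * c) := by
      refine NS.runs_of_eq (N := n) _ _ ?_ (by simp [u1, u2, hx5, hmnb]) (by simp [hc3])
      simp (config := { decide := true }) only [NS.ok, NOp.ok, hSt_MNB, u1, hmnb, ne_eq, EmbeddingLike.apply_eq_iff_eq, not_false_eq_true, true_and]; exact htn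
    have h3 : Runs (emit (Sum.inr (h .X5)) (Sum.inr (h .MNF))) (base (hSt h T u2))
        (base (hSt h T { u with mn0 := encodeNat (tdStep t s).1, mnf := outRev ((tdStep t s).2.map encodeNat) })) (4 * n + 3) := by
      refine (runs_emit (h := (Sum.inr (h .X5) : EReg ⊕ β)) (o := Sum.inr (h .MNF)) (by simp [hq_ne h (show HReg.X5 ≠ .MNF by decide)]) (base (hSt h T u2))).of_eq ?_ ?_
      · simp [u2, u1, tdStep, hd, hmnf, hfl1, hx5, List.map_append, outRev_append]
      · simp only [nst_inr, hSt_X5, u2]; omega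
    have gp := Runs.opop_true (k := h .FL1) (ct := tdEmit h) skip skip (T := hSt h T u1) (w := []) (by simp [u1]) (by rw [update_hSt_FL1]; exact h2.seq h3)
    exact (h1.seq gp).of_eq rfl (by omega)
  · -- not divisible
    let u1 : HSlots := { u with x4 := [], x5 := [], fl2 := [] }
    have h1 : Runs (tdTest h).com (base (hSt h T u)) (base (hSt h T u1)) (489 * c) := by
      refine NS.runs_of_eq (N := n) _ _ ?_ ?_ (by simp [tdTest, hc3])
      · simp (config := { decide := true }) only [tdTest, NS.ofList, NS.ok, NOp.ok, NS.eval, NOp.eval, hSt_X4, hSt_X5, hSt_MN0, hSt_MNB, hSt_FL2, hSt_X6, hSt_X3, hSt_FL1,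
          update_hSt_X4, update_hSt_X5, update_hSt_FL2, update_hSt_MN0, hmn0, hmnb, hx3, hx4, hx5, hx6, hfl1, hfl2, hd, bitsToNat_encodeNat, bitsToNat_nil,
          ne_eq, EmbeddingLike.apply_eq_iff_eq, not_false_eq_true, List.length_nil, zero_le, and_self, hlX, htn, hlq, hlr, decide_false, flag_false, true_and, and_true, or_true,
          false_and]
        omega
      · simp [tdTest, u1, hmn0, hmnb, hx3, hx5, hx6, hfl1, hfl2, hd]
    have gp := Runs.opop_nil (k := h .FL1) (tdEmit h) skip (T := hSt h T u1) (by simp [u1, hfl1]) (Runs.skip _)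
    refine (h1.seq gp).of_eq ?_ (by omega)
    simp [u1, tdStep, hd, hmn0, hmnf, hx4, hx5, hfl2]

/-- `tdRounds`, last round first. [folklore] -/
theorem tdRounds_succ' (t : ℕ) : ∀ (k : ℕ) (s : ℕ × List ℕ), tdRounds t (k + 1) s = tdStep t (tdRounds t k s)
  | 0, s => rfl
  | k + 1, s => by rw [tdRounds, tdRounds_succ' t k (tdStep t s), tdRounds]

/-- Cost of one division round. [folklore] -/
def tdInnerCost (n : ℕ) : ℕ := 502 * (n + 1) ^ 3 + 4 * n + 6

/-- Cost of one divisor. [folklore] -/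
def tdOuterCost (n nb : ℕ) : ℕ := 13 * (n + 1) ^ 3 + ((nb * (tdInnerCost n + 2) + 1) + 83 * (n + 1) ^ 3)

/-- Cost of trial division by `T` divisors. [folklore] -/
def tdivCost (n nb T : ℕ) : ℕ := 4 * (n + 1) ^ 3 + ((T * (tdOuterCost n nb + 2) + 1) + 3 * (n + 1) ^ 3)

/-- **One divisor.** [folklore] -/
theorem runs_tdOuter {N n nb j : ℕ} (hn : (encodeNat N).length + 1 ≤ n) (hnb : nb ≤ n) (hjn : (encodeNat (j + 3)).length ≤ n) (T : Regs β) (u : HSlots)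
    (hmnc : u.mnc = List.replicate nb true) (hu1 : u.u1 = [])
    (hx3 : u.x3 = []) (hx4 : u.x4 = []) (hx5 : u.x5 = []) (hx6 : u.x6 = []) (hfl1 : u.fl1 = []) (hfl2 : u.fl2 = []) :
    Runs (tdOuter h) (base (hSt h T { u with mnb := encodeNat (j + 2), mn0 := encodeNat (tdRun N nb j).1, mnf := outRev ((tdRun N nb j).2.map encodeNat) }))
      (base (hSt h T { u with mnb := encodeNat (j + 3), mn0 := encodeNat (tdRun N nb (j + 1)).1, mnf := outRev ((tdRun N nb (j + 1)).2.map encodeNat) })) (tdOuterCost n nb) := by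
  set c := (n + 1) ^ 3 with hc3
  have hj2 : (encodeNat (j + 2)).length ≤ n := (Brick.length_encodeNat_mono (by omega)).trans hjn
  set s := tdRun N nb j with hs0
  have hsN : s.1 ≤ N := (tdRun_facts N nb j).1
  let u0 : HSlots := { u with mnb := encodeNat (j + 2), mn0 := encodeNat s.1, mnf := outRev (s.2.map encodeNat) }
  let st : ℕ → HSlots := fun i => { u0 with u1 := List.replicate i true, mn0 := encodeNat (tdRounds (j + 2) (nb - i) s).1, mnf := outRev ((tdRounds (j + 2) (nb - i) s).2.map encodeNat) }
  have h1 : Runs ((NS.op (.copy (h .MNC) (h .U1)) : NS β).com) (base (hSt h T u0)) (base (hSt h T (st nb))) (13 * c) := by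
    refine NS.runs_of_eq (N := n) _ _ ?_ ?_ (by simp [hc3])
    · simp (config := { decide := true }) only [NS.ok, NOp.ok, hSt_MNC, u0, hmnc, List.length_replicate, ne_eq, EmbeddingLike.apply_eq_iff_eq, not_false_eq_true, true_and]; exact hnb
    · simp [u0, st, hmnc, hu1, tdRounds]
  have hL := runs_countLoop (U := (Sum.inr (h .U1) : EReg ⊕ β)) (body := tdInner h) (fun i R => i ≤ nb ∧ R = base (hSt h T (st i))) (tdInnerCost n)
    (by
      rintro i R ⟨hi, rfl⟩ -
      have hupd : Function.update (base (hSt h T (st (i + 1)))) (Sum.inr (h .U1)) (List.replicate i true) = base (hSt h T { st (i + 1) with u1 := List.replicate i true }) := by simp [st]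
      rw [hupd]
      have hfacts := tdRounds_facts (j + 2) (nb - (i + 1)) s
      refine ⟨_, (runs_tdInner h (N := N) (t := j + 2) hn T { st (i + 1) with u1 := List.replicate i true } (tdRounds (j + 2) (nb - (i + 1)) s) (hfacts.1.trans hsN) (by omega) hj2
        (by simp [st]) (by simp [st, u0]) (by simp [st]) (by simp [st, u0, hx3]) (by simp [st, u0, hx4]) (by simp [st, u0, hx5]) (by simp [st, u0, hx6]) (by simp [st, u0, hfl1])
        (by simp [st, u0, hfl2])).of_eq ?_ le_rfl, by simp [st], by omega, rfl⟩
      have e1 : nb - i = nb - (i + 1) + 1 := by omega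
      simp [st, e1, tdRounds_succ'])
    nb (base (hSt h T (st nb))) ⟨le_rfl, rfl⟩ (by simp [st])
  obtain ⟨R', hR, -, -, rfl⟩ := hL
  have h3 : Runs ((NS.ofList [.succ (h .X4) (h .MNB), .clear (h .MNB), .move (h .X4) (h .MNB)] : NS β).com) (base (hSt h T (st 0)))
      (base (hSt h T { u with mnb := encodeNat (j + 3), mn0 := encodeNat (tdRun N nb (j + 1)).1, mnf := outRev ((tdRun N nb (j + 1)).2.map encodeNat) })) (83 * c) := by
    refine NS.runs_of_eq (N := n) _ _ ?_ ?_ (by simp [hc3])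
    · simp (config := { decide := true }) only [NS.ofList, NS.ok, NOp.ok, NS.eval, NOp.eval, hSt_X4, hSt_MNB, update_hSt_X4, update_hSt_MNB, st, u0, hx4, bitsToNat_encodeNat,
        List.length_nil, ne_eq, EmbeddingLike.apply_eq_iff_eq, not_false_eq_true, hj2, hjn, zero_le, and_self]
    · simp [st, u0, hx4, hu1, tdRun, hs0]
  refine (h1.seq (hR.seq h3)).of_eq (by simp) ?_
  simp only [tdOuterCost, ← hc3]; omega

/-- **Trial division.** [folklore] -/
theorem runs_tdiv {N n nb Tn : ℕ} (hn : (encodeNat N).length + 1 ≤ n) (hnb : nb ≤ n) (hTn : (encodeNat (Tn + 2)).length ≤ n) (T : Regs β) (u : HSlots)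
    (hmnc : u.mnc = List.replicate nb true) (hu1 : u.u1 = []) (hmnb : u.mnb = []) (hmn0 : u.mn0 = encodeNat N) (hmnf : u.mnf = [])
    (hx3 : u.x3 = []) (hx4 : u.x4 = []) (hx5 : u.x5 = []) (hx6 : u.x6 = []) (hfl1 : u.fl1 = []) (hfl2 : u.fl2 = []) :
    Runs (tdiv h) (base (hSt h T { u with u2 := List.replicate Tn true }))
      (base (hSt h T { u with u2 := [], mn0 := encodeNat (tdRun N nb Tn).1, mnf := outRev ((tdRun N nb Tn).2.map encodeNat) })) (tdivCost n nb Tn) := by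
  set c := (n + 1) ^ 3 with hc3
  have hl2 : (encodeNat 2).length ≤ n := (Brick.length_encodeNat_mono (show 2 ≤ Tn + 2 by omega)).trans hTn
  let st : ℕ → HSlots := fun i => { u with u2 := List.replicate i true, mnb := encodeNat (Tn - i + 2), mn0 := encodeNat (tdRun N nb (Tn - i)).1, mnf := outRev ((tdRun N nb (Tn - i)).2.map encodeNat) }
  have h1 : Runs ((NS.op (.const (h .MNB) (encodeNat 2)) : NS β).com) (base (hSt h T { u with u2 := List.replicate Tn true })) (base (hSt h T (st Tn))) (4 * c) := by
    refine NS.runs_of_eq (N := n) _ _ ?_ ?_ (by simp [hc3])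
    · simp only [NS.ok, NOp.ok, hSt_MNB, hmnb, List.length_nil]; exact ⟨by omega, hl2⟩
    · simp [st, hmn0, hmnf, tdRun]
  have hL := runs_countLoop (U := (Sum.inr (h .U2) : EReg ⊕ β)) (body := tdOuter h) (fun i R => i ≤ Tn ∧ R = base (hSt h T (st i))) (tdOuterCost n nb)
    (by
      rintro i R ⟨hi, rfl⟩ -
      have hupd : Function.update (base (hSt h T (st (i + 1)))) (Sum.inr (h .U2)) (List.replicate i true) = base (hSt h T { ({ u with u2 := List.replicate i true } : HSlots) with mnb := encodeNat (Tn - (i + 1) + 2), mn0 := encodeNat (tdRun N nb (Tn - (i + 1))).1, mnf := outRev ((tdRun N nb (Tn - (i + 1))).2.map encodeNat) }) := by simp [st]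
      rw [hupd]
      have hjn : (encodeNat (Tn - (i + 1) + 3)).length ≤ n := (Brick.length_encodeNat_mono (by omega)).trans hTn
      have hr := runs_tdOuter h (N := N) (nb := nb) (j := Tn - (i + 1)) hn hnb hjn T { u with u2 := List.replicate i true } (by simp [hmnc]) (by simp [hu1]) (by simp [hx3]) (by simp [hx4])
        (by simp [hx5]) (by simp [hx6]) (by simp [hfl1]) (by simp [hfl2])
      refine ⟨_, hr.of_eq ?_ le_rfl, by simp [st], by omega, rfl⟩
      have e1 : Tn - i = Tn - (i + 1) + 1 := by omega
      simp [st, e1])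
    Tn (base (hSt h T (st Tn))) ⟨le_rfl, rfl⟩ (by simp [st])
  obtain ⟨R', hR, -, -, rfl⟩ := hL
  have h3 : Runs ((NS.op (.clear (h .MNB)) : NS β).com) (base (hSt h T (st 0)))
      (base (hSt h T { u with u2 := [], mn0 := encodeNat (tdRun N nb Tn).1, mnf := outRev ((tdRun N nb Tn).2.map encodeNat) })) (3 * c) := by
    refine NS.runs_of_eq (N := n) _ _ ?_ ?_ (by simp [hc3])
    · simp only [NS.ok, NOp.ok, hSt_MNB, st, Nat.sub_zero]; exact hTn
    · simp [st, hmnb]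
  refine (h1.seq (hR.seq h3)).of_eq rfl ?_
  simp only [tdivCost, ← hc3]; omega

end TrialDivision

section CorePrelim

/-! ### The per-number procedure: preliminaries

Writing the modulus `MD` and the constant `CINV = (N+1)/2` (ambient registers below the machine's
variables), and size facts of the base search. -/

/-- Writing the multiplier's constant `CINV` through the driver's base file. [folklore] -/
theorem update_gBase_CINV' (q : GReg ↪ β) (T : Regs β) (w : GSlots) (v : List Bool) :
    Function.update (gBase q T w) (q .CINV) v = gBase q (Function.update T (q .CINV) v) w := by
  funext y
  by_cases hy : y = q .CINV
  · subst hy; rw [Function.update_self, gBase_CINV, Function.update_self]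
  · rw [Function.update_of_ne hy]; simp only [gBase, Function.update_apply, hy, if_false]

/-- Writing `CINV` through the multiplier's state function. [folklore] -/
theorem update_gSt_CINV' (q : GReg ↪ β) (T : Regs β) (w : GSlots) (v : List Bool) :
    Function.update (gSt q T w) (q .CINV) v = gSt q (Function.update T (q .CINV) v) w := by
  have hne : ∀ i, (rFG q) i ≠ q .CINV := fun i h0 => by
    simp only [rFG, Function.Embedding.trans_apply, GReg.ιF_apply, EmbeddingLike.apply_eq_iff_eq] at h0
    exact GReg.noConfusion h0
  rw [gSt, update_fSt_of_ne (rFG q) _ _ hne, update_gBase_CINV', ← gSt]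

/-- Writing `CINV` through the machine's state function. [folklore] -/
theorem update_hSt_CINV (T : Regs β) (u : HSlots) (v : List Bool) :
    Function.update (hSt h T u) (h (.g .CINV)) v = hSt h (Function.update T (h (.g .CINV)) v) u := by
  rw [hSt, ← rGH_apply, update_gSt_CINV', rGH_apply, update_hBase_g]; rfl

/-- Writing the modulus `MD` through the machine's state function. [folklore] -/
theorem update_hSt_MD (T : Regs β) (u : HSlots) (v : List Bool) :
    Function.update (hSt h T u) (h (.g (.f (.n (.v .MD))))) v = hSt h (Function.update T (h (.g (.f (.n (.v .MD))))) v) u := by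
  rw [hSt, ← rGH_apply, update_gSt_v (rGH h) _ _ _ (by decide) (by decide) (by decide) (by decide) (by decide) (by decide), rGH_apply, update_hBase_g]; rfl

/-- Reading the modulus. [folklore] -/
theorem hSt_MD (T : Regs β) (u : HSlots) : hSt h T u (h (.g (.f (.n (.v .MD))))) = T (h (.g (.f (.n (.v .MD))))) :=
  hSt_gv h T u (by decide) (by decide) (by decide) (by decide) (by decide) (by decide)

/-- The multiplier's invariant after re-setting the modulus and `CINV`. [folklore] -/
theorem drvInv_setMod {N X : ℕ} {T : Regs β} (hI : DrvInv (rGH h) N T) (c : List Bool) :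
    DrvInv (rGH h) X (Function.update (Function.update T (h (.g (.f (.n (.v .MD))))) (encodeNat X)) (h (.g .CINV)) c) := by
  unfold DrvInv at hI ⊢
  simp only [rGH_apply, Function.update_apply, EmbeddingLike.apply_eq_iff_eq, reduceCtorEq, if_false, HReg.g.injEq, GReg.f.injEq, FReg.n.injEq, NReg.v.injEq,
    if_true] at hI ⊢
  exact ⟨trivial, hI.2⟩

/-- The modulus of the congruence stays below `LB · 4^e`. [folklore] -/
theorem sfBaseOut_L_le {N α e L LB M : ℕ} (hL1 : 1 ≤ L) (hLLB : L ≤ LB) : (sfBaseOut N α e L LB M).L ≤ LB * 2 ^ (2 * e) := by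
  have h4 : 1 ≤ 2 ^ (2 * e) := Nat.one_le_two_pow
  have hLle : L ≤ LB * 2 ^ (2 * e) := hLLB.trans (Nat.le_mul_of_pos_right _ h4)
  obtain ⟨hi, -, -⟩ := alg1Out_index_facts N α 1 (2 ^ e) (e + 2) e ((NegFFT.prodTreeH N e (sfValList N (α ^ 2 ^ e % N) (2 ^ e))).headD []) (sfValList N (α ^ 2 ^ e % N) (2 ^ e))
  obtain ⟨-, hh, -⟩ := alg1Out_index_facts N α 1 (2 ^ e) (e + 2) e ((NegFFT.prodTreeH N e (sfValList N (α ^ 2 ^ e % N) (2 ^ e))).headD []) (sfValList N (α ^ 2 ^ e % N) (2 ^ e))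
  simp only [sfBaseOut, sfDispOut]
  set o := alg1Out N α 1 (2 ^ e) (e + 2) e ((NegFFT.prodTreeH N e (sfValList N (α ^ 2 ^ e % N) (2 ^ e))).headD []) (sfValList N (α ^ 2 ^ e % N) (2 ^ e)) with ho
  rcases h1 : o.1 with _ | g
  · simp only
    rcases h2 : o.2.1 with _ | i₀
    · simpa using hLle
    · rcases h3 : o.2.2 with _ | h₀
      · simpa using hLle
      · simp only
        have hi₀ := hi i₀ h2
        have hh₀ := hh h₀ h3
        set es := (h₀ + 1) * 2 ^ e - i₀ with hes
        have hes1 : 1 ≤ es := by have : 2 ^ e ≤ (h₀ + 1) * 2 ^ e := Nat.le_mul_of_pos_left _ (by omega); omega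
        have hesle : es ≤ 2 ^ (2 * e) := by
          have : (h₀ + 1) * 2 ^ e ≤ 2 ^ e * 2 ^ e := Nat.mul_le_mul_right _ (by omega)
          rw [two_mul, pow_add]; omega
        have hK := divRun_fst_le N α hes1 (2 ^ e)
        have hK1 := divRun_fst_pos N α hes1 (2 ^ e)
        have hlcm : Nat.lcm L (divRun N α es (2 ^ e)).1 ≤ LB * 2 ^ (2 * e) :=
          (Nat.le_of_dvd (Nat.mul_pos hL1 hK1) (Nat.lcm_dvd_mul L _)).trans (Nat.mul_le_mul hLLB (hK.trans hesle))
        simp only [sfEOut]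
        rcases h4' : (divRun N α es (2 ^ e)).2 with _ | g'
        · simp only
          split_ifs with hth
          · rcases firstHit (classHit N (Nat.lcm L (divRun N α es (2 ^ e)).1)) (M / Nat.lcm L (divRun N α es (2 ^ e)).1) with _ | x₀
            · simpa using hlcm
            · simpa using hlcm
          · simpa using hlcm
        · simpa using hLle
  · simpa using hLle

/-- The modulus register of the search stays below `LB · 4^e`. [folklore] -/
theorem sfRun_L_le (N e LB M : ℕ) (hLB : 1 ≤ LB) : ∀ j, 1 ≤ (sfRun N e LB M j).2.1 ∧ (sfRun N e LB M j).2.1 ≤ LB * 2 ^ (2 * e)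
  | 0 => by simp [sfRun]; exact Nat.le_mul_of_pos_right _ Nat.one_le_two_pow |>.trans' hLB
  | j + 1 => by
    have hout : ∀ α L, 1 ≤ L → 1 ≤ (sfBaseOut N α e L LB M).L ∧ ((sfBaseOut N α e L LB M).stop = false → (sfBaseOut N α e L LB M).L < LB) :=
      fun α L hL => ⟨(sfBaseOut_facts N α e L LB M hL).1, fun hs => ((sfBaseOut_facts N α e L LB M hL).2 hs).1⟩
    have ih := sfRun_L_le N e LB M hLB j
    rcases hst : sfRun N e LB M j with ⟨α, L, r⟩
    rw [hst] at ih
    cases r with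
    | some out => rw [sfRun_succ_some hst]; exact ih
    | none =>
      rw [sfRun_succ_none hst]
      obtain ⟨hL1, hLLB⟩ := sfRun_L N e LB M hLB hout j (by rw [hst])
      rw [hst] at hL1 hLLB
      simp only at hL1 hLLB ⊢
      have h1 := (sfBaseOut_facts N (α + 1) e L LB M hL1).1
      have h2 := sfBaseOut_L_le (N := N) (α := α + 1) (e := e) (M := M) hL1 hLLB
      split_ifs <;> exact ⟨h1, h2⟩

end CorePrelim

section CoreSF

/-! ### The per-number procedure: one call of the base search

Registers on entry: `A1P = e`, `SFBMAX = LB`, `SFM = M`, `SFB = B`, `MNP = []`; on exit `MNP` holds the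
factor found (if any), and (variant B) `BLA` the last base and `FL2` the flag "the search stopped
clear at that base" (code `2`). -/

/-- The factor reported by the base search. [folklore] -/
def sfFac (st : ℕ × ℕ × Option SFOut) : Option ℕ := match st.2.2 with | some out => out.fac | none => none

/-- The result code of the base search (`0` if the bases were exhausted). [folklore] -/
def sfCode (st : ℕ × ℕ × Option SFOut) : ℕ := match st.2.2 with | some out => out.code | none => 0

/-- The code register after the search. [folklore] -/
def sfdOf (st : ℕ × ℕ × Option SFOut) : List Bool := match st.2.2 with | some out => encodeNat out.code | none => []

/-- The stop flag after the search. [folklore] -/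
def stopOf (st : ℕ × ℕ × Option SFOut) : List Bool := match st.2.2 with | some _ => [true] | none => []

/-- The registers after the search, uniformly. [folklore] -/
theorem sfAt_zero_eq (u : HSlots) (st : ℕ × ℕ × Option SFOut) (hsfd : u.sfd = []) (hsfdivs : u.sfdivs = []) (hsfr : u.sfr = []) (hsfbeta : u.sfbeta = []) :
    u.sfAt 0 st = { u with u2 := [], bla := encodeNat st.1, sfl := encodeNat st.2.1, sfd := sfdOf st, sfdivs := stopOf st, sfr := encOpt (sfFac st), sfbeta := flagOpt (sfFac st) } := by
  rcases st with ⟨α, L, _ | out⟩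
  · simp [HSlots.sfAt, sfdOf, stopOf, sfFac, encOpt, flagOpt, hsfd, hsfdivs, hsfr, hsfbeta]
  · simp [HSlots.sfAt, sfdOf, stopOf, sfFac]

/-- Size facts of the outcome of the search. [folklore] -/
theorem sfRun_outcome_facts {N e LB M B : ℕ} (hNodd : Odd N) (hN1 : 1 < N) (hLB : 1 ≤ LB) (hcop : ∀ a, 2 ≤ a → a ≤ B + 1 → Nat.Coprime a N) :
    let st := sfRun N e LB M B
    st.1 ≤ 1 + B ∧ 1 ≤ st.2.1 ∧ st.2.1 ≤ LB * 2 ^ (2 * e) ∧ sfCode st ≤ 3 ∧ (∀ g, sfFac st = some g → 1 < g ∧ g < N ∧ g ∣ N) := by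
  intro st
  obtain ⟨-, -, -, hfac, -, -, hcode, -⟩ := sfRun_spec (e := e) (LB := LB) (M := M) hNodd hN1 hLB hcop B le_rfl
  obtain ⟨hL1, hLle⟩ := sfRun_L_le N e LB M hLB B
  refine ⟨sfRun_fst N e LB M B, hL1, hLle, ?_, fun g hg => ?_⟩
  · simp only [sfCode]
    rcases hq : st.2.2 with _ | out
    · simp
    · have := hcode out hq; simp only; omega
  · simp only [sfFac] at hg
    rcases hq : st.2.2 with _ | out
    · rw [hq] at hg; simp at hg
    · rw [hq] at hg; exact hfac out g hq hg

/-- Collecting the outcome, variant A: the factor to `MNP`, everything else cleared. [folklore] -/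
def collectA : Com (EReg ⊕ β) :=
  ((NS.ofList [.move (h .SFR) (h .MNP), .clear (h .SFBETA), .clear (h .SFD), .clear (h .SFDIVS), .clear (h .A1P), .clear (h .SFBMAX), .clear (h .SFM), .clear (h .SFB)] : NS β).com) ;;
  (clear (Sum.inr (h .SFL)) ;; clear (Sum.inr (h .BLA)))

/-- Collecting the outcome, variant B: the factor to `MNP`, `FL2 := [code = 2]`, the base kept on `BLA`. [folklore] -/
def collectB : Com (EReg ⊕ β) :=
  ((NS.ofList [.move (h .SFR) (h .MNP), .clear (h .SFBETA), .const (h .X2) (encodeNat 2), .eq (h .FL2) (h .SFD) (h .X2) (h .X3), .clear (h .X2), .clear (h .SFD), .clear (h .SFDIVS),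
      .clear (h .A1P), .clear (h .SFBMAX), .clear (h .SFM), .clear (h .SFB)] : NS β).com) ;;
  clear (Sum.inr (h .SFL))

/-- Cost of a call of the search (either variant of the collection). [folklore] -/
def sfCallCost (n e M LB B : ℕ) : ℕ := sfSearchCost n e M LB B + (156 * (n + 1) ^ 3 + ((2 * n + 1) + (2 * n + 1)))

/-- **A call of the base search, variant A.** [folklore] -/
theorem runs_sfCallA {N n e LB M B : ℕ} (hNodd : Odd N) (hN1 : 1 < N) (hn : (encodeNat N).length + 1 ≤ n) (hen : 2 * e + 8 ≤ n)
    (T : Regs β) (hI : DrvInv (rGH h) N T) (hCI : T (h (.g .CINV)) = encodeNat (NegFFT.inv2N N))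
    (u : HSlots) (hw : u.gw.Clean) (hsched : u.gw.sched = []) (hhist : u.gw.hist = []) (hbg : u.gw.bg = []) (hkn' : u.gw.kn = []) (hbf : u.gw.bf = [])
    (hLB : 1 ≤ LB) (hlLBn : (encodeNat (LB * 2 ^ (2 * e))).length ≤ n) (hlM1 : (encodeNat (M + 1)).length ≤ n) (hBN : B + 2 ≤ N) (hlB : (encodeNat B).length ≤ n)
    (hcop : ∀ a, 2 ≤ a → a ≤ B + 1 → Nat.Coprime a N)
    (hblpow : u.blpow = encodeNat 2) (hmnp : u.mnp = [])
    (hbla : u.bla = []) (hsfl : u.sfl = []) (hu2 : u.u2 = [])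
    (hl1 : u.l1 = []) (hx1 : u.x1 = []) (hx2 : u.x2 = []) (hx3 : u.x3 = []) (hx4 : u.x4 = []) (hx5 : u.x5 = []) (hx6 : u.x6 = [])
    (hfl1 : u.fl1 = []) (hfl2 : u.fl2 = []) (hl2 : u.l2 = []) (hu1 : u.u1 = []) (hl4 : u.l4 = []) (hptk : u.ptk = []) (hptu : u.ptu = []) (hblf : u.blf = [])
    (hble : u.ble = []) (hblc1 : u.blc1 = []) (hblc2 : u.blc2 = []) (hblout : u.blout = []) (ha1i : u.a1i = []) (ha1ai : u.a1ai = []) (ha1g : u.a1g = [])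
    (hblg : u.blg = []) (hblfp : u.blfp = []) (ha1v : u.a1v = []) (ha1c : u.a1c = []) (hblm : u.blm = []) (hblk : u.blk = [])
    (hsfe : u.sfe = []) (hsfk : u.sfk = []) (hsft : u.sft = []) (hsfr : u.sfr = []) (hsfbeta : u.sfbeta = []) (hsfcand : u.sfcand = []) (hsfdivs : u.sfdivs = []) (hsfd : u.sfd = []) :
    Runs (sfSearch h ;; collectA h) (base (hSt h T { u with a1p := encodeNat e, sfbmax := encodeNat LB, sfm := encodeNat M, sfb := encodeNat B }))
      (base (hSt h T { u with a1p := [], sfbmax := [], sfm := [], sfb := [], mnp := encOpt (sfFac (sfRun N e LB M B)) })) (sfCallCost n e M LB B) := by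
  have hN0 : 0 < N := by omega
  set c := (n + 1) ^ 3 with hc3
  have hlN : (encodeNat N).length ≤ n := by omega
  let u0 : HSlots := { u with a1p := encodeNat e, sfbmax := encodeNat LB, sfm := encodeNat M, sfb := encodeNat B }
  have h1 := runs_sfSearch h hNodd hN1 hn hen T hI hCI u0 hw hsched hhist hbg hkn' hbf hLB hlLBn hlM1 hBN (by simp [u0]) (by simp [u0, hblpow]) (by simp [u0]) (by simp [u0]) (by simp [u0])
    (by simp [u0, hbla]) (by simp [u0, hsfl]) (by simp [u0, hu2]) (by simp [u0, hl1]) (by simp [u0, hx1]) (by simp [u0, hx2]) (by simp [u0, hx3]) (by simp [u0, hx4]) (by simp [u0, hx5])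
    (by simp [u0, hx6]) (by simp [u0, hfl1]) (by simp [u0, hfl2]) (by simp [u0, hl2]) (by simp [u0, hu1]) (by simp [u0, hl4]) (by simp [u0, hptk]) (by simp [u0, hptu]) (by simp [u0, hblf])
    (by simp [u0, hble]) (by simp [u0, hblc1]) (by simp [u0, hblc2]) (by simp [u0, hblout]) (by simp [u0, ha1i]) (by simp [u0, ha1ai]) (by simp [u0, ha1g]) (by simp [u0, hblg])
    (by simp [u0, hblfp]) (by simp [u0, ha1v]) (by simp [u0, ha1c]) (by simp [u0, hblm]) (by simp [u0, hblk]) (by simp [u0, hsfe]) (by simp [u0, hsfk]) (by simp [u0, hsft]) (by simp [u0, hsfr])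
    (by simp [u0, hsfbeta]) (by simp [u0, hsfcand]) (by simp [u0, hsfdivs]) (by simp [u0, hsfd])
  set st := sfRun N e LB M B with hst0
  rw [sfAt_zero_eq u0 st (by simp [u0, hsfd]) (by simp [u0, hsfdivs]) (by simp [u0, hsfr]) (by simp [u0, hsfbeta])] at h1
  obtain ⟨hα, hL1, hLle, hcode, hfac⟩ := sfRun_outcome_facts (e := e) (LB := LB) (M := M) (B := B) hNodd hN1 hLB hcop
  rw [← hst0] at hα hL1 hLle hcode hfac
  have hlα : (encodeNat st.1).length ≤ n := (Brick.length_encodeNat_mono (show st.1 ≤ N by omega)).trans hlN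
  have hlL : (encodeNat st.2.1).length ≤ n := (Brick.length_encodeNat_mono hLle).trans hlLBn
  have hlfac : (encOpt (sfFac st)).length ≤ n := by
    rcases hq : sfFac st with _ | g
    · simp [encOpt]
    · simp only [encOpt]; exact (Brick.length_encodeNat_mono (hfac g hq).2.1.le).trans hlN
  have hlcode : (sfdOf st).length ≤ n := by
    simp only [sfdOf]
    rcases hq : st.2.2 with _ | out
    · simp
    · simp only
      have : out.code ≤ 3 := by have := hcode; simp only [sfCode, hq] at this; exact this
      exact (Brick.length_encodeNat_mono this).trans ((show (encodeNat 3).length ≤ 2 by decide).trans (by omega))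
  have hlstop : (stopOf st).length ≤ n := by
    simp only [stopOf]; rcases st.2.2 with _ | _ <;> simp
    all_goals omega
  have hlflag : (flagOpt (sfFac st)).length ≤ n := by
    rcases sfFac st with _ | _ <;> simp [flagOpt]
    all_goals omega
  have hle : (encodeNat e).length ≤ n := (length_encodeNat_le_self _).trans (by omega)
  have hlLB : (encodeNat LB).length ≤ n := (Brick.length_encodeNat_mono (Nat.le_mul_of_pos_right _ Nat.one_le_two_pow)).trans hlLBn
  have hlM : (encodeNat M).length ≤ n := (Brick.length_encodeNat_mono (Nat.le_succ M)).trans hlM1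
  let u1 : HSlots := { u with u2 := [], bla := encodeNat st.1, sfl := encodeNat st.2.1, sfd := sfdOf st, sfdivs := stopOf st, sfr := encOpt (sfFac st), sfbeta := flagOpt (sfFac st), a1p := encodeNat e, sfbmax := encodeNat LB, sfm := encodeNat M, sfb := encodeNat B }
  have hu1 : ({ u0 with u2 := [], bla := encodeNat st.1, sfl := encodeNat st.2.1, sfd := sfdOf st, sfdivs := stopOf st, sfr := encOpt (sfFac st), sfbeta := flagOpt (sfFac st) } : HSlots) = u1 := by simp [u0, u1]
  rw [hu1] at h1
  let u2 : HSlots := { u with u2 := [], bla := encodeNat st.1, sfl := encodeNat st.2.1, sfd := [], sfdivs := [], sfr := [], sfbeta := [], a1p := [], sfbmax := [], sfm := [], sfb := [], mnp := encOpt (sfFac st) }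
  have h2 : Runs ((NS.ofList [.move (h .SFR) (h .MNP), .clear (h .SFBETA), .clear (h .SFD), .clear (h .SFDIVS), .clear (h .A1P), .clear (h .SFBMAX), .clear (h .SFM), .clear (h .SFB)] : NS β).com)
      (base (hSt h T u1)) (base (hSt h T u2)) (29 * c) := by
    refine NS.runs_of_eq (N := n) _ _ ?_ ?_ (by simp [hc3])
    · simp (config := { decide := true }) only [NS.ofList, NS.ok, NOp.ok, NS.eval, NOp.eval, hSt_SFR, hSt_MNP, hSt_SFBETA, hSt_SFD, hSt_SFDIVS, hSt_A1P, hSt_SFBMAX, hSt_SFM, hSt_SFB,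
        update_hSt_SFR, update_hSt_MNP, update_hSt_SFBETA, update_hSt_SFD, update_hSt_SFDIVS, update_hSt_A1P, update_hSt_SFBMAX, update_hSt_SFM, u1, hmnp,
        ne_eq, EmbeddingLike.apply_eq_iff_eq, not_false_eq_true, hlfac, hlflag, hlcode, hlstop, hle, hlLB, hlM, hlB, and_self]
    · simp [u1, u2, hmnp]
  have h3 : Runs (clear (Sum.inr (h .SFL))) (base (hSt h T u2)) (base (hSt h T { u2 with sfl := [] })) (2 * n + 1) := by
    refine (runs_oclear (h .SFL) (hSt h T u2)).of_eq (by simp) ?_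
    simp only [hSt_SFL, u2]; omega
  have h4 : Runs (clear (Sum.inr (h .BLA))) (base (hSt h T { u2 with sfl := [] })) (base (hSt h T { u with a1p := [], sfbmax := [], sfm := [], sfb := [], mnp := encOpt (sfFac (sfRun N e LB M B)) })) (2 * n + 1) := by
    refine (runs_oclear (h .BLA) (hSt h T { u2 with sfl := [] })).of_eq ?_ ?_
    · rw [update_hSt_BLA]; simp [u2, hst0, hu2, hbla, hsfl, hsfd, hsfdivs, hsfr, hsfbeta]
    · simp only [hSt_BLA, u2]; omega
  refine (h1.seq (h2.seq (h3.seq h4))).of_eq rfl ?_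
  simp only [sfCallCost, ← hc3]; omega

/-- The code register read as a number. [folklore] -/
theorem bitsToNat_sfdOf (st : ℕ × ℕ × Option SFOut) : bitsToNat (sfdOf st) = sfCode st := by
  rcases st with ⟨α, L, _ | out⟩ <;> simp [sfdOf, sfCode, bitsToNat_encodeNat]

/-- **A call of the base search, variant B** (the base kept, `FL2 := [code = 2]`). [folklore] -/
theorem runs_sfCallB {N n e LB M B : ℕ} (hNodd : Odd N) (hN1 : 1 < N) (hn : (encodeNat N).length + 1 ≤ n) (hen : 2 * e + 8 ≤ n)
    (T : Regs β) (hI : DrvInv (rGH h) N T) (hCI : T (h (.g .CINV)) = encodeNat (NegFFT.inv2N N))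
    (u : HSlots) (hw : u.gw.Clean) (hsched : u.gw.sched = []) (hhist : u.gw.hist = []) (hbg : u.gw.bg = []) (hkn' : u.gw.kn = []) (hbf : u.gw.bf = [])
    (hLB : 1 ≤ LB) (hlLBn : (encodeNat (LB * 2 ^ (2 * e))).length ≤ n) (hlM1 : (encodeNat (M + 1)).length ≤ n) (hBN : B + 2 ≤ N) (hlB : (encodeNat B).length ≤ n)
    (hcop : ∀ a, 2 ≤ a → a ≤ B + 1 → Nat.Coprime a N)
    (hblpow : u.blpow = encodeNat 2) (hmnp : u.mnp = [])
    (hbla : u.bla = []) (hsfl : u.sfl = []) (hu2 : u.u2 = [])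
    (hl1 : u.l1 = []) (hx1 : u.x1 = []) (hx2 : u.x2 = []) (hx3 : u.x3 = []) (hx4 : u.x4 = []) (hx5 : u.x5 = []) (hx6 : u.x6 = [])
    (hfl1 : u.fl1 = []) (hfl2 : u.fl2 = []) (hl2 : u.l2 = []) (hu1 : u.u1 = []) (hl4 : u.l4 = []) (hptk : u.ptk = []) (hptu : u.ptu = []) (hblf : u.blf = [])
    (hble : u.ble = []) (hblc1 : u.blc1 = []) (hblc2 : u.blc2 = []) (hblout : u.blout = []) (ha1i : u.a1i = []) (ha1ai : u.a1ai = []) (ha1g : u.a1g = [])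
    (hblg : u.blg = []) (hblfp : u.blfp = []) (ha1v : u.a1v = []) (ha1c : u.a1c = []) (hblm : u.blm = []) (hblk : u.blk = [])
    (hsfe : u.sfe = []) (hsfk : u.sfk = []) (hsft : u.sft = []) (hsfr : u.sfr = []) (hsfbeta : u.sfbeta = []) (hsfcand : u.sfcand = []) (hsfdivs : u.sfdivs = []) (hsfd : u.sfd = []) :
    Runs (sfSearch h ;; collectB h) (base (hSt h T { u with a1p := encodeNat e, sfbmax := encodeNat LB, sfm := encodeNat M, sfb := encodeNat B }))
      (base (hSt h T { u with a1p := [], sfbmax := [], sfm := [], sfb := [], mnp := encOpt (sfFac (sfRun N e LB M B)), bla := encodeNat (sfRun N e LB M B).1, fl2 := flag (decide (sfCode (sfRun N e LB M B) = 2)) }))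
      (sfCallCost n e M LB B) := by
  have hN0 : 0 < N := by omega
  set c := (n + 1) ^ 3 with hc3
  have hlN : (encodeNat N).length ≤ n := by omega
  have e2 : encodeNat 2 = [false, true] := by simpa using encodeNat_two_pow 1
  have hlen2 : (encodeNat 2).length ≤ n := by rw [e2]; simp only [List.length_cons, List.length_nil]; omega
  let u0 : HSlots := { u with a1p := encodeNat e, sfbmax := encodeNat LB, sfm := encodeNat M, sfb := encodeNat B }
  have h1 := runs_sfSearch h hNodd hN1 hn hen T hI hCI u0 hw hsched hhist hbg hkn' hbf hLB hlLBn hlM1 hBN (by simp [u0]) (by simp [u0, hblpow]) (by simp [u0]) (by simp [u0]) (by simp [u0])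
    (by simp [u0, hbla]) (by simp [u0, hsfl]) (by simp [u0, hu2]) (by simp [u0, hl1]) (by simp [u0, hx1]) (by simp [u0, hx2]) (by simp [u0, hx3]) (by simp [u0, hx4]) (by simp [u0, hx5])
    (by simp [u0, hx6]) (by simp [u0, hfl1]) (by simp [u0, hfl2]) (by simp [u0, hl2]) (by simp [u0, hu1]) (by simp [u0, hl4]) (by simp [u0, hptk]) (by simp [u0, hptu]) (by simp [u0, hblf])
    (by simp [u0, hble]) (by simp [u0, hblc1]) (by simp [u0, hblc2]) (by simp [u0, hblout]) (by simp [u0, ha1i]) (by simp [u0, ha1ai]) (by simp [u0, ha1g]) (by simp [u0, hblg])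
    (by simp [u0, hblfp]) (by simp [u0, ha1v]) (by simp [u0, ha1c]) (by simp [u0, hblm]) (by simp [u0, hblk]) (by simp [u0, hsfe]) (by simp [u0, hsfk]) (by simp [u0, hsft]) (by simp [u0, hsfr])
    (by simp [u0, hsfbeta]) (by simp [u0, hsfcand]) (by simp [u0, hsfdivs]) (by simp [u0, hsfd])
  set st := sfRun N e LB M B with hst0
  rw [sfAt_zero_eq u0 st (by simp [u0, hsfd]) (by simp [u0, hsfdivs]) (by simp [u0, hsfr]) (by simp [u0, hsfbeta])] at h1
  obtain ⟨hα, hL1, hLle, hcode, hfac⟩ := sfRun_outcome_facts (e := e) (LB := LB) (M := M) (B := B) hNodd hN1 hLB hcop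
  rw [← hst0] at hα hL1 hLle hcode hfac
  have hlα : (encodeNat st.1).length ≤ n := (Brick.length_encodeNat_mono (show st.1 ≤ N by omega)).trans hlN
  have hlL : (encodeNat st.2.1).length ≤ n := (Brick.length_encodeNat_mono hLle).trans hlLBn
  have hlfac : (encOpt (sfFac st)).length ≤ n := by
    rcases hq : sfFac st with _ | g
    · simp [encOpt]
    · simp only [encOpt]; exact (Brick.length_encodeNat_mono (hfac g hq).2.1.le).trans hlN
  have hlcode : (sfdOf st).length ≤ n := by
    simp only [sfdOf]
    rcases hq : st.2.2 with _ | out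
    · simp
    · simp only
      have : out.code ≤ 3 := by have := hcode; simp only [sfCode, hq] at this; exact this
      exact (Brick.length_encodeNat_mono this).trans ((show (encodeNat 3).length ≤ 2 by decide).trans (by omega))
  have hlstop : (stopOf st).length ≤ n := by
    simp only [stopOf]; rcases st.2.2 with _ | _ <;> simp
    all_goals omega
  have hlflag : (flagOpt (sfFac st)).length ≤ n := by
    rcases sfFac st with _ | _ <;> simp [flagOpt]
    all_goals omega
  have hle : (encodeNat e).length ≤ n := (length_encodeNat_le_self _).trans (by omega)
  have hlLB : (encodeNat LB).length ≤ n := (Brick.length_encodeNat_mono (Nat.le_mul_of_pos_right _ Nat.one_le_two_pow)).trans hlLBn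
  have hlM : (encodeNat M).length ≤ n := (Brick.length_encodeNat_mono (Nat.le_succ M)).trans hlM1
  let u1 : HSlots := { u with u2 := [], bla := encodeNat st.1, sfl := encodeNat st.2.1, sfd := sfdOf st, sfdivs := stopOf st, sfr := encOpt (sfFac st), sfbeta := flagOpt (sfFac st), a1p := encodeNat e, sfbmax := encodeNat LB, sfm := encodeNat M, sfb := encodeNat B }
  have hu1 : ({ u0 with u2 := [], bla := encodeNat st.1, sfl := encodeNat st.2.1, sfd := sfdOf st, sfdivs := stopOf st, sfr := encOpt (sfFac st), sfbeta := flagOpt (sfFac st) } : HSlots) = u1 := by simp [u0, u1]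
  rw [hu1] at h1
  let u2 : HSlots := { u with u2 := [], bla := encodeNat st.1, sfl := encodeNat st.2.1, sfd := [], sfdivs := [], sfr := [], sfbeta := [], a1p := [], sfbmax := [], sfm := [], sfb := [], mnp := encOpt (sfFac st), fl2 := flag (decide (sfCode st = 2)) }
  have h2 : Runs ((NS.ofList [.move (h .SFR) (h .MNP), .clear (h .SFBETA), .const (h .X2) (encodeNat 2), .eq (h .FL2) (h .SFD) (h .X2) (h .X3), .clear (h .X2), .clear (h .SFD), .clear (h .SFDIVS),
      .clear (h .A1P), .clear (h .SFBMAX), .clear (h .SFM), .clear (h .SFB)] : NS β).com) (base (hSt h T u1)) (base (hSt h T u2)) (153 * c) := by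
    refine NS.runs_of_eq (N := n) _ _ ?_ ?_ (by simp [hc3])
    · simp (config := { decide := true }) only [NS.ofList, NS.ok, NOp.ok, NS.eval, NOp.eval, hSt_SFR, hSt_MNP, hSt_SFBETA, hSt_X2, hSt_FL2, hSt_SFD, hSt_X3, hSt_SFDIVS, hSt_A1P, hSt_SFBMAX, hSt_SFM, hSt_SFB,
        update_hSt_SFR, update_hSt_MNP, update_hSt_SFBETA, update_hSt_X2, update_hSt_FL2, update_hSt_SFD, update_hSt_SFDIVS, update_hSt_A1P, update_hSt_SFBMAX, update_hSt_SFM, u1, hmnp, hx2, hx3, hfl2,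
        ne_eq, EmbeddingLike.apply_eq_iff_eq, not_false_eq_true, hlfac, hlflag, hlcode, hlstop, hle, hlLB, hlM, hlB, hlen2, List.length_nil, zero_le, and_self]
    · simp [u1, u2, hmnp, hx2, hx3, hfl2, bitsToNat_sfdOf, bitsToNat_encodeNat]
  have h3 : Runs (clear (Sum.inr (h .SFL))) (base (hSt h T u2))
      (base (hSt h T { u with a1p := [], sfbmax := [], sfm := [], sfb := [], mnp := encOpt (sfFac (sfRun N e LB M B)), bla := encodeNat (sfRun N e LB M B).1, fl2 := flag (decide (sfCode (sfRun N e LB M B) = 2)) })) (2 * n + 1) := by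
    refine (runs_oclear (h .SFL) (hSt h T u2)).of_eq ?_ ?_
    · rw [update_hSt_SFL]; simp [u2, hst0, hu2, hsfl, hsfd, hsfdivs, hsfr, hsfbeta]
    · simp only [hSt_SFL, u2]; omega
  refine (h1.seq (h2.seq h3)).of_eq rfl ?_
  simp only [sfCallCost, ← hc3]; omega

end CoreSF

section CoreParams

/-! ### The per-number procedure: parameters

From `nX = |enc X|`: `e₁ = ⌈nX/6⌉` (so `(4^{e₁})³ ≥ 2^{nX} > X`), `er = ⌊nX/5⌋` (`r = m = 2^{er}`),
`e₂ = ⌈(nX − er)/4⌉` (so `4^{e₂} · 4^{e₂} · r ≥ 2^{nX} > X`), `e₃ = ⌈(er+1)/2⌉`... (`4^{e₃} ≥ m`),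
`LB₃ = 2^{⌊3nX/10⌋ + 2}`. -/

/-- `e₁`. [folklore] -/
def cE1 (nX : ℕ) : ℕ := (nX + 5) / 6
/-- `er`. [folklore] -/
def cER (nX : ℕ) : ℕ := nX / 5
/-- `e₂`. [folklore] -/
def cE2 (nX : ℕ) : ℕ := (nX - nX / 5 + 3) / 4
/-- `e₃`. [folklore] -/
def cE3 (nX : ℕ) : ℕ := (nX / 5 + 1) / 2
/-- The exponent of `LB₃`. [folklore] -/
def cL3 (nX : ℕ) : ℕ := 3 * nX / 10 + 2

/-- The common tail: `SFBMAX := 2^{A1P}`, `SFM := SFBMAX²`, `SFB := B`. [folklore] -/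
def sfTail : Com (EReg ⊕ β) := pow2Into (rGH h) (h .SFBMAX) (h .A1P) ;; ((NS.ofList [.mul (h .SFM) (h .SFBMAX) (h .SFBMAX), .copy (h .MNB) (h .SFB)] : NS β).com)

/-- The parameters of the first search: `A1P := e₁`, then the tail. [folklore] -/
def c1Par : Com (EReg ⊕ β) :=
  ((NS.ofList [.len (h .X2) (h .MN0) (h .X3), .const (h .X3) (encodeNat 5), .add (h .X4) (h .X2) (h .X3), .clear (h .X3), .const (h .X3) (encodeNat 6),
      .divMod (h .A1P) (h .X5) (h .X4) (h .X3), .clear (h .X5), .clear (h .X4), .clear (h .X3), .clear (h .X2)] : NS β).com) ;; sfTail h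

/-- The parameters of the second search: `A1P := e₂`, then the tail. [folklore] -/
def c3Par : Com (EReg ⊕ β) :=
  ((NS.ofList [.len (h .X2) (h .MN0) (h .X3), .const (h .X3) (encodeNat 5), .divMod (h .X4) (h .X5) (h .X2) (h .X3), .clear (h .X5), .clear (h .X3), .sub (h .X5) (h .X2) (h .X4),
      .clear (h .X4), .clear (h .X2), .const (h .X3) (encodeNat 3), .add (h .X4) (h .X5) (h .X3), .clear (h .X5), .clear (h .X3), .const (h .X3) (encodeNat 4),
      .divMod (h .A1P) (h .X5) (h .X4) (h .X3), .clear (h .X5), .clear (h .X4), .clear (h .X3)] : NS β).com) ;; sfTail h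

/-- Cost of the tail. [folklore] -/
def sfTailCost (n : ℕ) : ℕ := (n * (16 * n + 21) + 3 * n + 7) + 283 * (n + 1) ^ 3

/-- **The tail.** [folklore] -/
theorem runs_sfTail {N n e B : ℕ} (hen : 2 * e + 2 ≤ n) (hlB : (encodeNat B).length ≤ n) (T : Regs β) (hI : DrvInv (rGH h) N T) (u : HSlots)
    (ha1p : u.a1p = encodeNat e) (hmnb : u.mnb = encodeNat B) (hsfbmax : u.sfbmax = []) (hsfm : u.sfm = []) (hsfb : u.sfb = []) :
    Runs (sfTail h) (base (hSt h T u)) (base (hSt h T { u with sfbmax := encodeNat (2 ^ e), sfm := encodeNat (2 ^ e * 2 ^ e), sfb := encodeNat B })) (sfTailCost n) := by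
  obtain ⟨-, -, -, -, -, -, -, -, -, -, hU, -, -, -, -, -, -, -⟩ := id hI
  have rdU : ∀ u' : HSlots, hSt h T u' ((rGH h) (.f (.n (.v .U)))) = [] := fun u' => by
    rw [rGH_apply, hSt_gv h T u' (by decide) (by decide) (by decide) (by decide) (by decide) (by decide)]; exact hU
  set c := (n + 1) ^ 3 with hc3
  have hen' : e ≤ n := by omega
  have hle : (encodeNat e).length ≤ n := (length_encodeNat_le_self _).trans hen'
  have hl2e : (encodeNat (2 ^ e)).length ≤ n := by rw [encodeNat_two_pow]; simp; omega
  let u1 : HSlots := { u with sfbmax := encodeNat (2 ^ e) }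
  have h1 : Runs (pow2Into (rGH h) (h .SFBMAX) (h .A1P)) (base (hSt h T u)) (base (hSt h T u1)) (n * (16 * e + 21) + 3 * e + 7) := by
    have hne : h .SFBMAX ≠ h .A1P := hq_ne h (by decide)
    have hneU : h .SFBMAX ≠ (rGH h) (.f (.n (.v .U))) := (rGH_ne h .SFBMAX (fun _ e => HReg.noConfusion e) _).symm
    have r1 : hSt h T u (h .A1P) = encodeNat e := by rw [hSt_A1P]; exact ha1p
    have r2 : hSt h T u (h .SFBMAX) = [] := by rw [hSt_SFBMAX]; exact hsfbmax
    refine (runs_pow2Into (rGH h) hneU hne hle (hSt h T u) r1 r2 (rdU u)).of_eq ?_ le_rfl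
    rw [update_hSt_SFBMAX]
  have h2 : Runs ((NS.ofList [.mul (h .SFM) (h .SFBMAX) (h .SFBMAX), .copy (h .MNB) (h .SFB)] : NS β).com) (base (hSt h T u1))
      (base (hSt h T { u with sfbmax := encodeNat (2 ^ e), sfm := encodeNat (2 ^ e * 2 ^ e), sfb := encodeNat B })) (283 * c) := by
    refine NS.runs_of_eq (N := n) _ _ ?_ ?_ (by simp [hc3])
    · simp (config := { decide := true }) only [NS.ofList, NS.ok, NOp.ok, NS.eval, NOp.eval, hSt_SFM, hSt_SFBMAX, hSt_MNB, update_hSt_SFM, u1, hsfm, hsfb, hmnb,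
        ne_eq, EmbeddingLike.apply_eq_iff_eq, not_false_eq_true, hl2e, hlB, List.length_nil, zero_le, and_self]
    · simp [u1, hsfm, hsfb, hmnb, bitsToNat_encodeNat]
  refine (h1.seq h2).of_eq rfl ?_
  have : n * (16 * e + 21) + 3 * e + 7 ≤ n * (16 * n + 21) + 3 * n + 7 := by
    have := Nat.mul_le_mul_left n (show 16 * e + 21 ≤ 16 * n + 21 by omega); omega
  simp only [sfTailCost, ← hc3]; omega

/-- Small numbers are short. [folklore] -/
theorem length_encodeNat_small {x n : ℕ} (hx : x ≤ n + 5) (hn : 8 ≤ n) : (encodeNat x).length ≤ n := by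
  have h1 : x ≤ 2 ^ (n - 1) := by
    have : n + 5 ≤ 2 ^ (n - 1) := by
      have h8 : ∀ k, 13 + k ≤ 2 ^ (7 + k) := fun k => by
        induction k with
        | zero => norm_num
        | succ k ih => rw [show 7 + (k + 1) = (7 + k) + 1 by omega, pow_succ]; omega
      have := h8 (n - 8); rw [show 7 + (n - 8) = n - 1 by omega] at this; omega
    omega
  exact (length_encodeNat_le_succ h1).trans (by omega)

/-- Cost of the parameters of the first search. [folklore] -/
def c1ParCost (n : ℕ) : ℕ := 600 * (n + 1) ^ 3 + sfTailCost n

/-- **The parameters of the first search.** [folklore] -/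
theorem runs_c1Par {N n X B : ℕ} (hn : (encodeNat N).length + 1 ≤ n) (hn8 : 8 ≤ n) (hXN : X ≤ N) (hlB : (encodeNat B).length ≤ n) (T : Regs β) (hI : DrvInv (rGH h) N T) (u : HSlots)
    (hmn0 : u.mn0 = encodeNat X) (hmnb : u.mnb = encodeNat B) (ha1p : u.a1p = []) (hsfbmax : u.sfbmax = []) (hsfm : u.sfm = []) (hsfb : u.sfb = [])
    (hx2 : u.x2 = []) (hx3 : u.x3 = []) (hx4 : u.x4 = []) (hx5 : u.x5 = []) :
    let e := cE1 (encodeNat X).length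
    Runs (c1Par h) (base (hSt h T u)) (base (hSt h T { u with a1p := encodeNat e, sfbmax := encodeNat (2 ^ e), sfm := encodeNat (2 ^ e * 2 ^ e), sfb := encodeNat B })) (c1ParCost n) := by
  intro e
  set c := (n + 1) ^ 3 with hc3
  set nX := (encodeNat X).length with hnX
  have hnXn : nX ≤ n := by have := Brick.length_encodeNat_mono hXN; omega
  have hlnX : (encodeNat nX).length ≤ n := length_encodeNat_small (by omega) hn8
  have hl5 : (encodeNat 5).length ≤ n := length_encodeNat_small (by omega) hn8
  have hl6 : (encodeNat 6).length ≤ n := length_encodeNat_small (by omega) hn8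
  have hlnX5 : (encodeNat (nX + 5)).length ≤ n := length_encodeNat_small (by omega) hn8
  have hlr : (encodeNat ((nX + 5) % 6)).length ≤ n := length_encodeNat_small (by omega) hn8
  let u1 : HSlots := { u with a1p := encodeNat e }
  have h1 : Runs ((NS.ofList [.len (h .X2) (h .MN0) (h .X3), .const (h .X3) (encodeNat 5), .add (h .X4) (h .X2) (h .X3), .clear (h .X3), .const (h .X3) (encodeNat 6),
      .divMod (h .A1P) (h .X5) (h .X4) (h .X3), .clear (h .X5), .clear (h .X4), .clear (h .X3), .clear (h .X2)] : NS β).com) (base (hSt h T u)) (base (hSt h T u1)) (600 * c) := by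
    refine NS.runs_of_eq (N := n) _ _ ?_ ?_ (by simp [hc3])
    · simp (config := { decide := true }) only [NS.ofList, NS.ok, NOp.ok, NS.eval, NOp.eval, hSt_X2, hSt_MN0, hSt_X3, hSt_X4, hSt_A1P, hSt_X5, update_hSt_X2, update_hSt_X3, update_hSt_X4,
        update_hSt_A1P, update_hSt_X5, hmn0, hx2, hx3, hx4, hx5, ha1p, ← hnX, bitsToNat_encodeNat, ne_eq, EmbeddingLike.apply_eq_iff_eq, not_false_eq_true,
        hnXn, hlnX, hl5, hl6, hlnX5, hlr, List.length_nil, zero_le, and_self]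
    · simp [u1, hmn0, hx2, hx3, hx4, hx5, ha1p, ← hnX, bitsToNat_encodeNat, e, cE1]
  have hen : 2 * e + 2 ≤ n := by simp only [e, cE1]; omega
  have h2 := runs_sfTail h (N := N) (e := e) (B := B) hen hlB T hI u1 (by simp [u1]) (by simp [u1, hmnb]) (by simp [u1, hsfbmax]) (by simp [u1, hsfm]) (by simp [u1, hsfb])
  refine (h1.seq h2).of_eq (by simp [u1]) ?_
  simp only [c1ParCost, ← hc3]; omega

/-- Cost of the parameters of the second search. [folklore] -/
def c3ParCost (n : ℕ) : ℕ := 1300 * (n + 1) ^ 3 + sfTailCost n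

/-- **The parameters of the second search.** [folklore] -/
theorem runs_c3Par {N n X B : ℕ} (hn : (encodeNat N).length + 1 ≤ n) (hn8 : 8 ≤ n) (hXN : X ≤ N) (hlB : (encodeNat B).length ≤ n) (T : Regs β) (hI : DrvInv (rGH h) N T) (u : HSlots)
    (hmn0 : u.mn0 = encodeNat X) (hmnb : u.mnb = encodeNat B) (ha1p : u.a1p = []) (hsfbmax : u.sfbmax = []) (hsfm : u.sfm = []) (hsfb : u.sfb = [])
    (hx2 : u.x2 = []) (hx3 : u.x3 = []) (hx4 : u.x4 = []) (hx5 : u.x5 = []) :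
    let e := cE2 (encodeNat X).length
    Runs (c3Par h) (base (hSt h T u)) (base (hSt h T { u with a1p := encodeNat e, sfbmax := encodeNat (2 ^ e), sfm := encodeNat (2 ^ e * 2 ^ e), sfb := encodeNat B })) (c3ParCost n) := by
  intro e
  set c := (n + 1) ^ 3 with hc3
  set nX := (encodeNat X).length with hnX
  have hnXn : nX ≤ n := by have := Brick.length_encodeNat_mono hXN; omega
  have hlnX : (encodeNat nX).length ≤ n := length_encodeNat_small (by omega) hn8
  have hl5 : (encodeNat 5).length ≤ n := length_encodeNat_small (by omega) hn8
  have hl3 : (encodeNat 3).length ≤ n := length_encodeNat_small (by omega) hn8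
  have hl4 : (encodeNat 4).length ≤ n := length_encodeNat_small (by omega) hn8
  have hlq : (encodeNat (nX / 5)).length ≤ n := length_encodeNat_small (by omega) hn8
  have hlr5 : (encodeNat (nX % 5)).length ≤ n := length_encodeNat_small (by omega) hn8
  have hld : (encodeNat (nX - nX / 5)).length ≤ n := length_encodeNat_small (by omega) hn8
  have hld3 : (encodeNat (nX - nX / 5 + 3)).length ≤ n := length_encodeNat_small (by omega) hn8
  have hlr4 : (encodeNat ((nX - nX / 5 + 3) % 4)).length ≤ n := length_encodeNat_small (by omega) hn8
  let u1 : HSlots := { u with a1p := encodeNat e }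
  have h1 : Runs ((NS.ofList [.len (h .X2) (h .MN0) (h .X3), .const (h .X3) (encodeNat 5), .divMod (h .X4) (h .X5) (h .X2) (h .X3), .clear (h .X5), .clear (h .X3), .sub (h .X5) (h .X2) (h .X4),
      .clear (h .X4), .clear (h .X2), .const (h .X3) (encodeNat 3), .add (h .X4) (h .X5) (h .X3), .clear (h .X5), .clear (h .X3), .const (h .X3) (encodeNat 4),
      .divMod (h .A1P) (h .X5) (h .X4) (h .X3), .clear (h .X5), .clear (h .X4), .clear (h .X3)] : NS β).com) (base (hSt h T u)) (base (hSt h T u1)) (1300 * c) := by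
    refine NS.runs_of_eq (N := n) _ _ ?_ ?_ (by simp [hc3])
    · simp (config := { decide := true }) only [NS.ofList, NS.ok, NOp.ok, NS.eval, NOp.eval, hSt_X2, hSt_MN0, hSt_X3, hSt_X4, hSt_A1P, hSt_X5, update_hSt_X2, update_hSt_X3, update_hSt_X4,
        update_hSt_A1P, update_hSt_X5, hmn0, hx2, hx3, hx4, hx5, ha1p, ← hnX, bitsToNat_encodeNat, ne_eq, EmbeddingLike.apply_eq_iff_eq, not_false_eq_true,
        hnXn, hlnX, hl5, hl3, hl4, hlq, hlr5, hld, hld3, hlr4, List.length_nil, zero_le, and_self, Nat.div_le_self]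
    · simp [u1, hmn0, hx2, hx3, hx4, hx5, ha1p, ← hnX, bitsToNat_encodeNat, e, cE2]
  have hen : 2 * e + 2 ≤ n := by simp only [e, cE2]; omega
  have h2 := runs_sfTail h (N := N) (e := e) (B := B) hen hlB T hI u1 (by simp [u1]) (by simp [u1, hmnb]) (by simp [u1, hsfbmax]) (by simp [u1, hsfm]) (by simp [u1, hsfb])
  refine (h1.seq h2).of_eq (by simp [u1]) ?_
  simp only [c3ParCost, ← hc3]; omega

/-- The parameters of the third search (the order search): `A1P := e₃`, `SFBMAX := 2^{cL3}`, `SFM := ⌊√X⌋`, `SFB := B`;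
also the exponent `er` is left on `A2M` for Algorithm 2. [folklore] -/
def c4Par : Com (EReg ⊕ β) :=
  ((NS.ofList [.len (h .X2) (h .MN0) (h .X3), .const (h .X3) (encodeNat 5), .divMod (h .A2M) (h .X5) (h .X2) (h .X3), .clear (h .X5), .clear (h .X3), .succ (h .X5) (h .A2M),
      .const (h .X3) (encodeNat 2), .divMod (h .A1P) (h .X4) (h .X5) (h .X3), .clear (h .X4), .clear (h .X5), .const (h .X4) (encodeNat 3), .mul (h .X5) (h .X2) (h .X4),
      .clear (h .X4), .clear (h .X2), .const (h .X4) (encodeNat 10), .divMod (h .X2) (h .X6) (h .X5) (h .X4), .clear (h .X6), .clear (h .X5), .clear (h .X4),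
      .add (h .X4) (h .X2) (h .X3), .clear (h .X2), .clear (h .X3)] : NS β).com) ;;
  (pow2Into (rGH h) (h .SFBMAX) (h .X4) ;; (((NS.op (.clear (h .X4))) : NS β).com ;; (isqrtAt h .MN0 ;; ((NS.ofList [.move (h .SQ1) (h .SFM), .copy (h .MNB) (h .SFB)] : NS β).com))))

/-- Cost of the parameters of the third search. [folklore] -/
def c4ParCost (n : ℕ) : ℕ := 1910 * (n + 1) ^ 3 + (n * (16 * n + 21) + 3 * n + 7) + isqrtCost n

/-- **The parameters of the third search.** [folklore] -/
theorem runs_c4Par {N n X B : ℕ} (hn : (encodeNat N).length + 1 ≤ n) (hn8 : 8 ≤ n) (hXN : X ≤ N) (hlB : (encodeNat B).length ≤ n) (hcl : cL3 (encodeNat X).length + 2 ≤ n)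
    (T : Regs β) (hI : DrvInv (rGH h) N T) (u : HSlots)
    (hmn0 : u.mn0 = encodeNat X) (hmnb : u.mnb = encodeNat B) (ha1p : u.a1p = []) (hsfbmax : u.sfbmax = []) (hsfm : u.sfm = []) (hsfb : u.sfb = []) (ha2m : u.a2m = [])
    (hx2 : u.x2 = []) (hx3 : u.x3 = []) (hx4 : u.x4 = []) (hx5 : u.x5 = []) (hx6 : u.x6 = []) (hsq1 : u.sq1 = []) (hsq2 : u.sq2 = []) (hsq3 : u.sq3 = []) (hsq4 : u.sq4 = []) (hsq5 : u.sq5 = []) :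
    let nX := (encodeNat X).length
    Runs (c4Par h) (base (hSt h T u))
      (base (hSt h T { u with a2m := encodeNat (cER nX), a1p := encodeNat (cE3 nX), sfbmax := encodeNat (2 ^ cL3 nX), sfm := encodeNat (Nat.sqrt X), sfb := encodeNat B })) (c4ParCost n) := by
  intro nX
  obtain ⟨-, -, -, -, -, -, -, -, -, -, hU, -, -, -, -, -, -, -⟩ := id hI
  have rdU : ∀ u' : HSlots, hSt h T u' ((rGH h) (.f (.n (.v .U)))) = [] := fun u' => by
    rw [rGH_apply, hSt_gv h T u' (by decide) (by decide) (by decide) (by decide) (by decide) (by decide)]; exact hU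
  set c := (n + 1) ^ 3 with hc3
  have hnX : (encodeNat X).length = nX := rfl
  have hnXn : nX ≤ n := by have := Brick.length_encodeNat_mono hXN; rw [hnX] at this; omega
  have hlX : (encodeNat X).length ≤ n := hnXn
  have hlnX : (encodeNat nX).length ≤ n := length_encodeNat_small (by omega) hn8
  have hl5 : (encodeNat 5).length ≤ n := length_encodeNat_small (by omega) hn8
  have hl3 : (encodeNat 3).length ≤ n := length_encodeNat_small (by omega) hn8
  have hl2 : (encodeNat 2).length ≤ n := length_encodeNat_small (by omega) hn8
  have hl10 : (encodeNat 10).length ≤ n := (Brick.length_encodeNat_mono (show 10 ≤ 16 by omega)).trans (by rw [show (16 : ℕ) = 2 ^ 4 by norm_num, encodeNat_two_pow]; simp; omega)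
  have hlq : (encodeNat (nX / 5)).length ≤ n := length_encodeNat_small (by omega) hn8
  have hlr5 : (encodeNat (nX % 5)).length ≤ n := length_encodeNat_small (by omega) hn8
  have hlq1 : (encodeNat (nX / 5 + 1)).length ≤ n := length_encodeNat_small (by omega) hn8
  have hlr2 : (encodeNat ((nX / 5 + 1) % 2)).length ≤ n := length_encodeNat_small (by omega) hn8
  have hl3n' : (encodeNat (nX * 3)).length ≤ n := by
    have h1 : nX * 3 ≤ 2 ^ (n - 1) := by
      have h8 : ∀ k, 3 * (8 + k) ≤ 2 ^ (7 + k) := fun k => by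
        induction k with
        | zero => norm_num
        | succ k ih => rw [show 7 + (k + 1) = (7 + k) + 1 by omega, pow_succ]; omega
      have := h8 (n - 8); rw [show 7 + (n - 8) = n - 1 by omega] at this
      have : nX * 3 ≤ 3 * (8 + (n - 8)) := by omega
      omega
    exact (length_encodeNat_le_succ h1).trans (by omega)
  have hlq10 : (encodeNat (nX * 3 / 10)).length ≤ n := (Brick.length_encodeNat_mono (Nat.div_le_self _ _)).trans hl3n'
  have hlr10 : (encodeNat (nX * 3 % 10)).length ≤ n := length_encodeNat_small (by omega) hn8
  have hlL : (encodeNat (nX * 3 / 10 + 2)).length ≤ n := (length_encodeNat_le_self _).trans (by simp only [cL3] at hcl; omega)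
  let u1 : HSlots := { u with a2m := encodeNat (nX / 5), a1p := encodeNat ((nX / 5 + 1) / 2), x4 := encodeNat (nX * 3 / 10 + 2) }
  have h1 : Runs ((NS.ofList [.len (h .X2) (h .MN0) (h .X3), .const (h .X3) (encodeNat 5), .divMod (h .A2M) (h .X5) (h .X2) (h .X3), .clear (h .X5), .clear (h .X3), .succ (h .X5) (h .A2M),
      .const (h .X3) (encodeNat 2), .divMod (h .A1P) (h .X4) (h .X5) (h .X3), .clear (h .X4), .clear (h .X5), .const (h .X4) (encodeNat 3), .mul (h .X5) (h .X2) (h .X4),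
      .clear (h .X4), .clear (h .X2), .const (h .X4) (encodeNat 10), .divMod (h .X2) (h .X6) (h .X5) (h .X4), .clear (h .X6), .clear (h .X5), .clear (h .X4),
      .add (h .X4) (h .X2) (h .X3), .clear (h .X2), .clear (h .X3)] : NS β).com) (base (hSt h T u)) (base (hSt h T u1)) (1884 * c) := by
    refine NS.runs_of_eq (N := n) _ _ ?_ ?_ (by simp [hc3])
    · simp (config := { decide := true }) only [NS.ofList, NS.ok, NOp.ok, NS.eval, NOp.eval, hSt_X2, hSt_MN0, hSt_X3, hSt_X4, hSt_A1P, hSt_X5, hSt_X6, hSt_A2M, update_hSt_X2, update_hSt_X3, update_hSt_X4,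
        update_hSt_A1P, update_hSt_X5, update_hSt_X6, update_hSt_A2M, hmn0, hx2, hx3, hx4, hx5, hx6, ha1p, ha2m, hnX, bitsToNat_encodeNat, ne_eq, EmbeddingLike.apply_eq_iff_eq, not_false_eq_true,
        hnXn, hlnX, hl5, hl3, hl2, hl10, hlq, hlr5, hlq1, hlr2, hl3n', hlq10, hlr10, List.length_nil, zero_le, and_self]
    · simp [u1, hmn0, hx2, hx3, hx4, hx5, hx6, ha1p, ha2m, hnX, bitsToNat_encodeNat]
  let u2 : HSlots := { u1 with sfbmax := encodeNat (2 ^ (nX * 3 / 10 + 2)) }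
  have h2 : Runs (pow2Into (rGH h) (h .SFBMAX) (h .X4)) (base (hSt h T u1)) (base (hSt h T u2)) (n * (16 * (nX * 3 / 10 + 2) + 21) + 3 * (nX * 3 / 10 + 2) + 7) := by
    have hne : h .SFBMAX ≠ h .X4 := hq_ne h (by decide)
    have hneU : h .SFBMAX ≠ (rGH h) (.f (.n (.v .U))) := (rGH_ne h .SFBMAX (fun _ e => HReg.noConfusion e) _).symm
    have r1 : hSt h T u1 (h .X4) = encodeNat (nX * 3 / 10 + 2) := by rw [hSt_X4]
    have r2 : hSt h T u1 (h .SFBMAX) = [] := by rw [hSt_SFBMAX]; exact hsfbmax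
    refine (runs_pow2Into (rGH h) hneU hne hlL (hSt h T u1) r1 r2 (rdU u1)).of_eq ?_ le_rfl
    rw [update_hSt_SFBMAX]
  let u3 : HSlots := { u2 with x4 := [] }
  have h3 : Runs ((NS.op (.clear (h .X4)) : NS β).com) (base (hSt h T u2)) (base (hSt h T u3)) (3 * c) :=
    NS.runs_of_eq (N := n) _ _ (by simp only [NS.ok, NOp.ok, hSt_X4, u2, u1]; exact hlL) (by simp [u2, u3]) (by simp [hc3])
  have h4 : Runs (isqrtAt h .MN0) (base (hSt h T u3)) (base (hSt h T { u3 with sq1 := encodeNat (Nat.sqrt X) })) (isqrtCost n) :=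
    runs_isqrtAt h (S := .MN0) (by decide) hlX T u3 (by simp [u3, u2, u1, hmn0]) (by simp [u3, u2, u1, hsq1]) (by simp [u3, u2, u1, hsq2]) (by simp [u3, u2, u1, hsq3]) (by simp [u3, u2, u1, hsq4])
      (by simp [u3, u2, u1, hsq5]) (by simp [u3, u2, u1, hx6])
  have hlsq : (encodeNat (Nat.sqrt X)).length ≤ n := (Brick.length_encodeNat_mono (Nat.sqrt_le_self X)).trans hlX
  have h5 : Runs ((NS.ofList [.move (h .SQ1) (h .SFM), .copy (h .MNB) (h .SFB)] : NS β).com) (base (hSt h T { u3 with sq1 := encodeNat (Nat.sqrt X) }))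
      (base (hSt h T { u with a2m := encodeNat (cER nX), a1p := encodeNat (cE3 nX), sfbmax := encodeNat (2 ^ cL3 nX), sfm := encodeNat (Nat.sqrt X), sfb := encodeNat B })) (21 * c) := by
    refine NS.runs_of_eq (N := n) _ _ ?_ ?_ (by simp [hc3])
    · simp (config := { decide := true }) only [NS.ofList, NS.ok, NOp.ok, NS.eval, NOp.eval, hSt_SQ1, hSt_SFM, hSt_MNB, update_hSt_SQ1, update_hSt_SFM, u3, u2, u1, hsfm, hmnb,
        ne_eq, EmbeddingLike.apply_eq_iff_eq, not_false_eq_true, hlsq, hlB, and_self]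
    · simp [u3, u2, u1, hsfm, hsfb, hmnb, hx4, hsq1, cER, cE3, cL3, show 3 * nX = nX * 3 from Nat.mul_comm _ _]
  refine (h1.seq (h2.seq (h3.seq (h4.seq h5)))).of_eq rfl ?_
  have : n * (16 * (nX * 3 / 10 + 2) + 21) + 3 * (nX * 3 / 10 + 2) + 7 ≤ n * (16 * n + 21) + 3 * n + 7 := by
    have hq : nX * 3 / 10 + 2 ≤ n := by simp only [cL3] at hcl; omega
    have := Nat.mul_le_mul_left n (show 16 * (nX * 3 / 10 + 2) + 21 ≤ 16 * n + 21 by omega); omega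
  simp only [c4ParCost, ← hc3]; omega

end CoreParams

section CoreStages

/-! ### The per-number procedure: the stages

Stage 1: the base search with `e₁` (a factor, or "no prime factor `≤ 4^{e₁}`", whence at most two
prime factors); stage 2: the square test; stage 3: the base search with `e₂` (a factor, or
"`p > 4^{e₂} ≥ √(X/r)`"); stage 4: the order search with `e₃` (a factor, "`X` is prime", or a base
`α` of order `> 4^{e₃} ≥ m` modulo every prime factor) followed by Algorithm 2.  Each stage runs
only while no factor has been found (`MNP = []`). -/

/-- The lengths of the parameters of a search with `LB = 2^e`, `M = 4^e`. [folklore] -/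
theorem sfParams_lengths {e n : ℕ} (h3 : 3 * e + 2 ≤ n) :
    (encodeNat (2 ^ e * 2 ^ (2 * e))).length ≤ n ∧ (encodeNat (2 ^ e * 2 ^ e + 1)).length ≤ n := by
  constructor
  · rw [← pow_add, encodeNat_two_pow]; simp; omega
  · have : 2 ^ e * 2 ^ e + 1 ≤ 2 ^ (2 * e + 1) := by rw [← pow_add, pow_succ]; have := Nat.one_le_two_pow (n := e + e); rw [two_mul]; omega
    exact (length_encodeNat_le_succ this).trans (by omega)

/-- Stage 1. [folklore] -/
def stage1 : Com (EReg ⊕ β) := c1Par h ;; (sfSearch h ;; collectA h)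

/-- Stage 3. [folklore] -/
def stage3 : Com (EReg ⊕ β) := c3Par h ;; (sfSearch h ;; collectA h)

/-- The outcome of stage 1. [folklore] -/
def stage1Out (X B : ℕ) : Option ℕ := let e := cE1 (encodeNat X).length; sfFac (sfRun X e (2 ^ e) (2 ^ e * 2 ^ e) B)

/-- The outcome of stage 3. [folklore] -/
def stage3Out (X B : ℕ) : Option ℕ := let e := cE2 (encodeNat X).length; sfFac (sfRun X e (2 ^ e) (2 ^ e * 2 ^ e) B)

/-- Cost of stage 1. [folklore] -/
def stage1Cost (n nX B : ℕ) : ℕ := let e := cE1 nX; c1ParCost n + sfCallCost n e (2 ^ e * 2 ^ e) (2 ^ e) B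

/-- Cost of stage 3. [folklore] -/
def stage3Cost (n nX B : ℕ) : ℕ := let e := cE2 nX; c3ParCost n + sfCallCost n e (2 ^ e * 2 ^ e) (2 ^ e) B

/-- **Stage 1.** [folklore] -/
theorem runs_stage1 {X n B : ℕ} (hXodd : Odd X) (hX1 : 1 < X) (hn : (encodeNat X).length + 1 ≤ n) (hn20 : 20 ≤ n)
    (T : Regs β) (hI : DrvInv (rGH h) X T) (hCI : T (h (.g .CINV)) = encodeNat (NegFFT.inv2N X))
    (u : HSlots) (hw : u.gw.Clean) (hsched : u.gw.sched = []) (hhist : u.gw.hist = []) (hbg : u.gw.bg = []) (hkn' : u.gw.kn = []) (hbf : u.gw.bf = [])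
    (hBX : B + 2 ≤ X) (hlB : (encodeNat B).length ≤ n) (hcop : ∀ a, 2 ≤ a → a ≤ B + 1 → Nat.Coprime a X)
    (hmn0 : u.mn0 = encodeNat X) (hmnb : u.mnb = encodeNat B) (hblpow : u.blpow = encodeNat 2) (hmnp : u.mnp = [])
    (ha1p : u.a1p = []) (hsfbmax : u.sfbmax = []) (hsfm : u.sfm = []) (hsfb : u.sfb = []) (hbla : u.bla = []) (hsfl : u.sfl = []) (hu2 : u.u2 = [])
    (hl1 : u.l1 = []) (hx1 : u.x1 = []) (hx2 : u.x2 = []) (hx3 : u.x3 = []) (hx4 : u.x4 = []) (hx5 : u.x5 = []) (hx6 : u.x6 = [])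
    (hfl1 : u.fl1 = []) (hfl2 : u.fl2 = []) (hl2 : u.l2 = []) (hu1 : u.u1 = []) (hl4 : u.l4 = []) (hptk : u.ptk = []) (hptu : u.ptu = []) (hblf : u.blf = [])
    (hble : u.ble = []) (hblc1 : u.blc1 = []) (hblc2 : u.blc2 = []) (hblout : u.blout = []) (ha1i : u.a1i = []) (ha1ai : u.a1ai = []) (ha1g : u.a1g = [])
    (hblg : u.blg = []) (hblfp : u.blfp = []) (ha1v : u.a1v = []) (ha1c : u.a1c = []) (hblm : u.blm = []) (hblk : u.blk = [])
    (hsfe : u.sfe = []) (hsfk : u.sfk = []) (hsft : u.sft = []) (hsfr : u.sfr = []) (hsfbeta : u.sfbeta = []) (hsfcand : u.sfcand = []) (hsfdivs : u.sfdivs = []) (hsfd : u.sfd = []) :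
    Runs (stage1 h) (base (hSt h T u)) (base (hSt h T { u with mnp := encOpt (stage1Out X B) })) (stage1Cost n (encodeNat X).length B) := by
  set nX := (encodeNat X).length with hnX
  set e := cE1 nX with he
  have hnXn : nX + 1 ≤ n := hn
  have he6 : e ≤ nX / 6 + 1 := by rw [he, cE1]; omega
  have h3e : 3 * e + 2 ≤ n := by omega
  obtain ⟨hlLBn, hlM1⟩ := sfParams_lengths h3e
  have h1 := runs_c1Par h (N := X) (X := X) (B := B) hn (by omega) le_rfl hlB T hI u hmn0 hmnb ha1p hsfbmax hsfm hsfb hx2 hx3 hx4 hx5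
  rw [← hnX] at h1
  change Runs (c1Par h) _ (base (hSt h T { u with a1p := encodeNat e, sfbmax := encodeNat (2 ^ e), sfm := encodeNat (2 ^ e * 2 ^ e), sfb := encodeNat B })) _ at h1
  have h2 := runs_sfCallA h (N := X) (e := e) (LB := 2 ^ e) (M := 2 ^ e * 2 ^ e) (B := B) hXodd hX1 hn (by omega) T hI hCI u hw hsched hhist hbg hkn' hbf Nat.one_le_two_pow hlLBn hlM1 hBX hlB hcop
    hblpow hmnp hbla hsfl hu2 hl1 hx1 hx2 hx3 hx4 hx5 hx6 hfl1 hfl2 hl2 hu1 hl4 hptk hptu hblf hble hblc1 hblc2 hblout ha1i ha1ai ha1g hblg hblfp ha1v ha1c hblm hblk hsfe hsfk hsft hsfr hsfbeta hsfcand hsfdivs hsfd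
  refine (h1.seq h2).of_eq ?_ ?_
  · simp [stage1Out, ← hnX, ← he, ha1p, hsfbmax, hsfm, hsfb]
  · simp only [stage1Cost, ← he]; exact le_rfl

/-- **Stage 3.** [folklore] -/
theorem runs_stage3 {X n B : ℕ} (hXodd : Odd X) (hX1 : 1 < X) (hn : (encodeNat X).length + 1 ≤ n) (hn20 : 20 ≤ n)
    (T : Regs β) (hI : DrvInv (rGH h) X T) (hCI : T (h (.g .CINV)) = encodeNat (NegFFT.inv2N X))
    (u : HSlots) (hw : u.gw.Clean) (hsched : u.gw.sched = []) (hhist : u.gw.hist = []) (hbg : u.gw.bg = []) (hkn' : u.gw.kn = []) (hbf : u.gw.bf = [])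
    (hBX : B + 2 ≤ X) (hlB : (encodeNat B).length ≤ n) (hcop : ∀ a, 2 ≤ a → a ≤ B + 1 → Nat.Coprime a X)
    (hmn0 : u.mn0 = encodeNat X) (hmnb : u.mnb = encodeNat B) (hblpow : u.blpow = encodeNat 2) (hmnp : u.mnp = [])
    (ha1p : u.a1p = []) (hsfbmax : u.sfbmax = []) (hsfm : u.sfm = []) (hsfb : u.sfb = []) (hbla : u.bla = []) (hsfl : u.sfl = []) (hu2 : u.u2 = [])
    (hl1 : u.l1 = []) (hx1 : u.x1 = []) (hx2 : u.x2 = []) (hx3 : u.x3 = []) (hx4 : u.x4 = []) (hx5 : u.x5 = []) (hx6 : u.x6 = [])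
    (hfl1 : u.fl1 = []) (hfl2 : u.fl2 = []) (hl2 : u.l2 = []) (hu1 : u.u1 = []) (hl4 : u.l4 = []) (hptk : u.ptk = []) (hptu : u.ptu = []) (hblf : u.blf = [])
    (hble : u.ble = []) (hblc1 : u.blc1 = []) (hblc2 : u.blc2 = []) (hblout : u.blout = []) (ha1i : u.a1i = []) (ha1ai : u.a1ai = []) (ha1g : u.a1g = [])
    (hblg : u.blg = []) (hblfp : u.blfp = []) (ha1v : u.a1v = []) (ha1c : u.a1c = []) (hblm : u.blm = []) (hblk : u.blk = [])
    (hsfe : u.sfe = []) (hsfk : u.sfk = []) (hsft : u.sft = []) (hsfr : u.sfr = []) (hsfbeta : u.sfbeta = []) (hsfcand : u.sfcand = []) (hsfdivs : u.sfdivs = []) (hsfd : u.sfd = []) :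
    Runs (stage3 h) (base (hSt h T u)) (base (hSt h T { u with mnp := encOpt (stage3Out X B) })) (stage3Cost n (encodeNat X).length B) := by
  set nX := (encodeNat X).length with hnX
  set e := cE2 nX with he
  have hnXn : nX + 1 ≤ n := hn
  have he5 : e ≤ nX / 5 + 1 := by rw [he, cE2]; omega
  have h3e : 3 * e + 2 ≤ n := by omega
  obtain ⟨hlLBn, hlM1⟩ := sfParams_lengths h3e
  have h1 := runs_c3Par h (N := X) (X := X) (B := B) hn (by omega) le_rfl hlB T hI u hmn0 hmnb ha1p hsfbmax hsfm hsfb hx2 hx3 hx4 hx5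
  rw [← hnX] at h1
  change Runs (c3Par h) _ (base (hSt h T { u with a1p := encodeNat e, sfbmax := encodeNat (2 ^ e), sfm := encodeNat (2 ^ e * 2 ^ e), sfb := encodeNat B })) _ at h1
  have h2 := runs_sfCallA h (N := X) (e := e) (LB := 2 ^ e) (M := 2 ^ e * 2 ^ e) (B := B) hXodd hX1 hn (by omega) T hI hCI u hw hsched hhist hbg hkn' hbf Nat.one_le_two_pow hlLBn hlM1 hBX hlB hcop
    hblpow hmnp hbla hsfl hu2 hl1 hx1 hx2 hx3 hx4 hx5 hx6 hfl1 hfl2 hl2 hu1 hl4 hptk hptu hblf hble hblc1 hblc2 hblout ha1i ha1ai ha1g hblg hblfp ha1v ha1c hblm hblk hsfe hsfk hsft hsfr hsfbeta hsfcand hsfdivs hsfd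
  refine (h1.seq h2).of_eq ?_ ?_
  · simp [stage3Out, ← hnX, ← he, ha1p, hsfbmax, hsfm, hsfb]
  · simp only [stage3Cost, ← he]; exact le_rfl

/-- Stage 2: the square test. [folklore] -/
def stage2 : Com (EReg ⊕ β) :=
  isqrtAt h .MN0 ;; (((NS.ofList [.mul (h .X2) (h .SQ1) (h .SQ1), .eq (h .FL2) (h .X2) (h .MN0) (h .X3), .clear (h .X2)] : NS β).com) ;;
    (NS.ite (h .FL2) (NS.op (.move (h .SQ1) (h .MNP))) (NS.op (.clear (h .SQ1)))).com)

/-- The outcome of the square test. [folklore] -/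
def sqFac (X : ℕ) : Option ℕ := if Nat.sqrt X * Nat.sqrt X = X then some (Nat.sqrt X) else none

/-- Cost of stage 2. [folklore] -/
def stage2Cost (n : ℕ) : ℕ := isqrtCost n + 400 * (n + 1) ^ 3

/-- **Stage 2.** [folklore] -/
theorem runs_stage2 {X n : ℕ} (hn : (encodeNat X).length + 1 ≤ n) (T : Regs β) (u : HSlots)
    (hmn0 : u.mn0 = encodeNat X) (hmnp : u.mnp = []) (hx2 : u.x2 = []) (hx3 : u.x3 = []) (hx6 : u.x6 = []) (hfl2 : u.fl2 = [])
    (hsq1 : u.sq1 = []) (hsq2 : u.sq2 = []) (hsq3 : u.sq3 = []) (hsq4 : u.sq4 = []) (hsq5 : u.sq5 = []) :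
    Runs (stage2 h) (base (hSt h T u)) (base (hSt h T { u with mnp := encOpt (sqFac X) })) (stage2Cost n) := by
  set c := (n + 1) ^ 3 with hc3
  have hlX : (encodeNat X).length ≤ n := by omega
  have hlsq : (encodeNat (Nat.sqrt X)).length ≤ n := (Brick.length_encodeNat_mono (Nat.sqrt_le_self X)).trans hlX
  have hlsq2 : (encodeNat (Nat.sqrt X * Nat.sqrt X)).length ≤ n := (Brick.length_encodeNat_mono (Nat.sqrt_le X)).trans hlX
  have h1 : Runs (isqrtAt h .MN0) (base (hSt h T u)) (base (hSt h T { u with sq1 := encodeNat (Nat.sqrt X) })) (isqrtCost n) :=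
    runs_isqrtAt h (S := .MN0) (by decide) hlX T u (by simp [hmn0]) hsq1 hsq2 hsq3 hsq4 hsq5 hx6
  let u1 : HSlots := { u with sq1 := encodeNat (Nat.sqrt X) }
  by_cases hsq : Nat.sqrt X * Nat.sqrt X = X
  · have h2 : Runs (((NS.ofList [.mul (h .X2) (h .SQ1) (h .SQ1), .eq (h .FL2) (h .X2) (h .MN0) (h .X3), .clear (h .X2)] : NS β).com) ;;
        (NS.ite (h .FL2) (NS.op (.move (h .SQ1) (h .MNP))) (NS.op (.clear (h .SQ1)))).com) (base (hSt h T u1)) (base (hSt h T { u with mnp := encOpt (sqFac X) })) (400 * c) := by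
      have hA : Runs ((NS.ofList [.mul (h .X2) (h .SQ1) (h .SQ1), .eq (h .FL2) (h .X2) (h .MN0) (h .X3), .clear (h .X2)] : NS β).com) (base (hSt h T u1)) (base (hSt h T { u1 with fl2 := [true] })) (390 * c) := by
        refine NS.runs_of_eq (N := n) _ _ ?_ ?_ (by simp [hc3])
        · simp (config := { decide := true }) only [NS.ofList, NS.ok, NOp.ok, NS.eval, NOp.eval, hSt_X2, hSt_SQ1, hSt_FL2, hSt_MN0, hSt_X3, update_hSt_X2, update_hSt_FL2, u1, hmn0, hx2, hx3, hfl2,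
            bitsToNat_encodeNat, hsq, ne_eq, EmbeddingLike.apply_eq_iff_eq, not_false_eq_true, hlsq, hlX, List.length_nil, zero_le, and_self]
        · simp [u1, hmn0, hx2, hx3, hfl2, bitsToNat_encodeNat, hsq]
      have hB : Runs (NS.ite (h .FL2) (NS.op (.move (h .SQ1) (h .MNP))) (NS.op (.clear (h .SQ1)))).com (base (hSt h T { u1 with fl2 := [true] })) (base (hSt h T { u with mnp := encOpt (sqFac X) })) (10 * c) := by
        refine NS.runs_of_eq (N := n) _ _ ?_ ?_ (by simp [hc3])
        · simp (config := { decide := true }) only [NS.ok, NOp.ok, hSt_FL2, hSt_SQ1, update_hSt_FL2, u1, hmnp, ne_eq, EmbeddingLike.apply_eq_iff_eq, not_false_eq_true, hlsq,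
            and_self, true_or]
        · simp [u1, hmnp, hfl2, hsq1, sqFac, hsq, encOpt]
      exact (hA.seq hB).of_eq rfl (by omega)
    exact (h1.seq h2).of_eq rfl (by simp only [stage2Cost, ← hc3]; omega)
  · have h2 : Runs (((NS.ofList [.mul (h .X2) (h .SQ1) (h .SQ1), .eq (h .FL2) (h .X2) (h .MN0) (h .X3), .clear (h .X2)] : NS β).com) ;;
        (NS.ite (h .FL2) (NS.op (.move (h .SQ1) (h .MNP))) (NS.op (.clear (h .SQ1)))).com) (base (hSt h T u1)) (base (hSt h T { u with mnp := encOpt (sqFac X) })) (400 * c) := by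
      have hA : Runs ((NS.ofList [.mul (h .X2) (h .SQ1) (h .SQ1), .eq (h .FL2) (h .X2) (h .MN0) (h .X3), .clear (h .X2)] : NS β).com) (base (hSt h T u1)) (base (hSt h T { u1 with fl2 := [] })) (390 * c) := by
        refine NS.runs_of_eq (N := n) _ _ ?_ ?_ (by simp [hc3])
        · simp (config := { decide := true }) only [NS.ofList, NS.ok, NOp.ok, NS.eval, NOp.eval, hSt_X2, hSt_SQ1, hSt_FL2, hSt_MN0, hSt_X3, update_hSt_X2, update_hSt_FL2, u1, hmn0, hx2, hx3, hfl2,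
            bitsToNat_encodeNat, hsq, ne_eq, EmbeddingLike.apply_eq_iff_eq, not_false_eq_true, hlsq, hlsq2, hlX, List.length_nil, zero_le, and_self]
        · simp [u1, hmn0, hx2, hx3, hfl2, bitsToNat_encodeNat, hsq]
      have hB : Runs (NS.ite (h .FL2) (NS.op (.move (h .SQ1) (h .MNP))) (NS.op (.clear (h .SQ1)))).com (base (hSt h T { u1 with fl2 := [] })) (base (hSt h T { u with mnp := encOpt (sqFac X) })) (10 * c) := by
        refine NS.runs_of_eq (N := n) _ _ ?_ ?_ (by simp [hc3])
        · simp (config := { decide := true }) only [NS.ok, NOp.ok, hSt_FL2, hSt_SQ1, update_hSt_FL2, u1, hmnp, ne_eq, EmbeddingLike.apply_eq_iff_eq, not_false_eq_true, hlsq,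
            and_self, or_true, reduceCtorEq, false_and]
        · simp [u1, hmnp, hfl2, hsq1, sqFac, hsq, encOpt]
      exact (hA.seq hB).of_eq rfl (by omega)
    exact (h1.seq h2).of_eq rfl (by simp only [stage2Cost, ← hc3]; omega)

end CoreStages

section CoreAssembly

/-! ### The per-number procedure: the order search with Algorithm 2, and the assembly -/

/-- `2^{|enc X| − 1} ≤ X` for `X ≥ 1`. [folklore] -/
theorem two_pow_length_pred_le {X : ℕ} (hX : 1 ≤ X) : 2 ^ ((encodeNat X).length - 1) ≤ X := by
  rw [TM2Pass.length_encodeNat_eq_size]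
  have hs : 0 < Nat.size X := Nat.size_pos.2 (by omega)
  exact Nat.lt_size.1 (by omega)

/-- A value reported by Algorithm 2 is at most `N` (a gcd with `N`, or a proper divisor). [folklore] -/
theorem a2Out_le {N α m r g : ℕ} (hN1 : 1 < N) (hg : a2Out N α m r = some g) : g ≤ N := by
  have hN0 : 0 < N := by omega
  unfold a2Out at hg
  rcases hfh : firstHit (powHit N α) (m - 1) with _ | i₀
  · rw [hfh] at hg; simp only at hg
    unfold a2FinOut at hg
    rcases hfd : (a2Res N α m r).found with _ | g'
    · rw [hfd] at hg; simp only at hg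
      split_ifs at hg
      unfold a2SixOut at hg
      exact (alg1Out_factor hN1 hg).2.1.le
    · rw [hfd] at hg; simp only at hg
      obtain rfl := Option.some.inj hg
      exact (scanRun_found_proper hN0 _ ScanSt.init (by simp [ScanSt.init]) g' hfd).2.1.le
  · rw [hfh] at hg; simp only at hg
    obtain rfl := Option.some.inj hg
    exact powGcd_le hN0 _ _

/-- The call of Algorithm 2: `A2Y := 2^{A2M}`, `A2R := A2Y`, Algorithm 2, the factor to `MNP`, clean-up. [folklore] -/
def a2Call : Com (EReg ⊕ β) :=
  pow2Into (rGH h) (h .A2Y) (h .A2M) ;; (((NS.ofList [.copy (h .A2Y) (h .A2R), .clear (h .A2M)]) : NS β).com ;; (alg2 h ;;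
    ((NS.ofList [.move (h .A2P) (h .MNP), .clear (h .A2Q), .clear (h .BLA), .clear (h .A2Y), .clear (h .A2R)] : NS β).com)))

/-- Stage 5: Algorithm 2 when the order search stopped clear (and no factor is known). [folklore] -/
def stage5 : Com (EReg ⊕ β) :=
  whenCons h .MNP ((NS.ofList [.clear (h .FL2), .clear (h .BLA), .clear (h .A2M)] : NS β).com)
    (Com.pop (Sum.inr (h .FL2)) (a2Call h) skip ((NS.ofList [.clear (h .BLA), .clear (h .A2M)] : NS β).com))

/-- Stages 4–5: the order search followed by Algorithm 2. [folklore] -/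
def stage45 : Com (EReg ⊕ β) := c4Par h ;; ((sfSearch h ;; collectB h) ;; stage5 h)

/-- The state of the order search. [folklore] -/
def stage4St (X B : ℕ) : ℕ × ℕ × Option SFOut := let nX := (encodeNat X).length; sfRun X (cE3 nX) (2 ^ cL3 nX) (Nat.sqrt X) B

/-- The outcome of stages 4–5. [folklore] -/
def stage45Out (X B : ℕ) : Option ℕ :=
  let st := stage4St X B
  let m := 2 ^ cER (encodeNat X).length
  (sfFac st).or (if sfCode st = 2 then a2Out X st.1 m m else none)

/-- Cost of the call of Algorithm 2. [folklore] -/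
def a2CallCost (n X α m : ℕ) : ℕ := (n * (16 * n + 21) + 3 * n + 7) + (16 * (n + 1) ^ 3 + (alg2Cost X n α m m + 20 * (n + 1) ^ 3))

/-- Cost of stage 5. [folklore] -/
def stage5Cost (n X α m : ℕ) : ℕ := a2CallCost n X α m + 9 * (n + 1) ^ 3 + 6

/-- Cost of stages 4–5 (the worst case of stage 5: the call of Algorithm 2 at the base actually reached). [folklore] -/
def stage45Cost (n X B : ℕ) : ℕ :=
  let nX := (encodeNat X).length
  c4ParCost n + (sfCallCost n (cE3 nX) (Nat.sqrt X) (2 ^ cL3 nX) B + stage5Cost n X (stage4St X B).1 (2 ^ cER nX))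

/-- **The call of Algorithm 2.** [folklore] -/
theorem runs_a2Call {X n α er : ℕ} (hXodd : Odd X) (hX1 : 1 < X) (hn4 : 4 * (encodeNat X).length + 20 ≤ n) (hnX : 10 ≤ (encodeNat X).length) (her : er = cER (encodeNat X).length)
    (hαX : α < X) (T : Regs β) (hI : DrvInv (rGH h) X T) (hCI : T (h (.g .CINV)) = encodeNat (NegFFT.inv2N X))
    (u : HSlots) (hw : u.gw.Clean) (hsched : u.gw.sched = []) (hhist : u.gw.hist = []) (hbg : u.gw.bg = []) (hkn' : u.gw.kn = []) (hbf : u.gw.bf = [])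
    (hbla : u.bla = encodeNat α) (ha2m : u.a2m = encodeNat er) (hblpow : u.blpow = encodeNat 2) (hmnp : u.mnp = []) (ha2y : u.a2y = []) (ha2r : u.a2r = [])
    (ha2d : u.a2d = []) (ha2u : u.a2u = []) (ha2al : u.a2al = []) (ha2s : u.a2s = []) (ha2jj : u.a2jj = []) (ha2c : u.a2c = []) (ha2am : u.a2am = [])
    (ha2p : u.a2p = []) (ha2q : u.a2q = []) (ha2t : u.a2t = []) (ha2j : u.a2j = []) (ha2v : u.a2v = []) (ha2a : u.a2a = []) (ha2b : u.a2b = [])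
    (ha2l1 : u.a2l1 = []) (ha2l2 : u.a2l2 = []) (ha2srt : u.a2srt = []) (hl4 : u.l4 = [])
    (hx1 : u.x1 = []) (hx2 : u.x2 = []) (hx3 : u.x3 = []) (hx4 : u.x4 = []) (hx5 : u.x5 = []) (hx6 : u.x6 = []) (hfl1 : u.fl1 = []) (hfl2 : u.fl2 = [])
    (hu1 : u.u1 = []) (hu2 : u.u2 = []) (hsq1 : u.sq1 = []) (hsq2 : u.sq2 = []) (hsq3 : u.sq3 = []) (hsq4 : u.sq4 = []) (hsq5 : u.sq5 = [])
    (hrx1 : u.rx1 = []) (hrx2 : u.rx2 = []) (hrx3 : u.rx3 = []) (hrx4 : u.rx4 = []) (hrx5 : u.rx5 = []) (hrx6 : u.rx6 = []) (hrx7 : u.rx7 = []) (hrx8 : u.rx8 = []) (hrx9 : u.rx9 = [])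
    (hsfk : u.sfk = []) (hsfe : u.sfe = []) (hsfcand : u.sfcand = []) (hsfbeta : u.sfbeta = []) (hsfdivs : u.sfdivs = []) (hsfr : u.sfr = []) (hsft : u.sft = [])
    (ha1c : u.a1c = []) (hblm : u.blm = []) (ha1v : u.a1v = []) (ha1p : u.a1p = []) (hblk : u.blk = []) (hl1 : u.l1 = [])
    (hptk : u.ptk = []) (hptu : u.ptu = []) (hblf : u.blf = []) (hble : u.ble = []) (hblc1 : u.blc1 = []) (hblc2 : u.blc2 = []) (hblout : u.blout = [])
    (ha1i : u.a1i = []) (ha1ai : u.a1ai = []) (ha1g : u.a1g = []) (hblg : u.blg = []) (hblfp : u.blfp = []) :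
    Runs (a2Call h) (base (hSt h T u)) (base (hSt h T { u with bla := [], a2m := [], mnp := encOpt (a2Out X α (2 ^ er) (2 ^ er)) })) (a2CallCost n X α (2 ^ er)) := by
  obtain ⟨-, -, -, -, -, -, -, -, -, -, hU, -, -, -, -, -, -, -⟩ := id hI
  have rdU : ∀ u' : HSlots, hSt h T u' ((rGH h) (.f (.n (.v .U)))) = [] := fun u' => by
    rw [rGH_apply, hSt_gv h T u' (by decide) (by decide) (by decide) (by decide) (by decide) (by decide)]; exact hU
  set c := (n + 1) ^ 3 with hc3
  set nX := (encodeNat X).length with hnX0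
  set m := 2 ^ er with hm0
  have hX0 : 0 < X := by omega
  have hlN : (encodeNat X).length ≤ n := by omega
  have herle : er ≤ nX / 5 := by rw [her, cER]
  have hler : (encodeNat er).length ≤ n := (length_encodeNat_le_self _).trans (by omega)
  have hlm : (encodeNat m).length ≤ n := by rw [hm0, encodeNat_two_pow]; simp; omega
  have hmX : 4 * m * m ≤ X := by
    have h1 : 4 * m * m = 2 ^ (2 * er + 2) := by rw [hm0, show 2 * er + 2 = er + er + 2 by ring, pow_add, pow_add]; ring
    have h2 : 2 * er + 2 ≤ nX - 1 := by omega
    rw [h1]; exact (Nat.pow_le_pow_right (by omega) h2).trans (two_pow_length_pred_le (by omega))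
  have hm1 : 1 ≤ m := Nat.one_le_two_pow
  have hmN : m ≤ X := by nlinarith
  have hnr : 4 * (encodeNat m).length + (encodeNat X).length + 4 ≤ n := by rw [hm0, encodeNat_two_pow]; simp; omega
  have hlα : (encodeNat α).length ≤ n := (Brick.length_encodeNat_mono hαX.le).trans hlN
  let u1 : HSlots := { u with a2y := encodeNat m }
  have h1 : Runs (pow2Into (rGH h) (h .A2Y) (h .A2M)) (base (hSt h T u)) (base (hSt h T u1)) (n * (16 * er + 21) + 3 * er + 7) := by
    have hne : h .A2Y ≠ h .A2M := hq_ne h (by decide)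
    have hneU : h .A2Y ≠ (rGH h) (.f (.n (.v .U))) := (rGH_ne h .A2Y (fun _ e => HReg.noConfusion e) _).symm
    have r1 : hSt h T u (h .A2M) = encodeNat er := by rw [hSt_A2M]; exact ha2m
    have r2 : hSt h T u (h .A2Y) = [] := by rw [hSt_A2Y]; exact ha2y
    refine (runs_pow2Into (rGH h) hneU hne hler (hSt h T u) r1 r2 (rdU u)).of_eq ?_ le_rfl
    rw [update_hSt_A2Y]
  let u2 : HSlots := { u with a2y := encodeNat m, a2r := encodeNat m, a2m := [] }
  have h2 : Runs (((NS.ofList [.copy (h .A2Y) (h .A2R), .clear (h .A2M)]) : NS β).com) (base (hSt h T u1)) (base (hSt h T u2)) (16 * c) := by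
    refine NS.runs_of_eq (N := n) _ _ ?_ ?_ (by simp [hc3])
    · simp (config := { decide := true }) only [NS.ofList, NS.ok, NOp.ok, NS.eval, NOp.eval, hSt_A2Y, hSt_A2R, hSt_A2M, update_hSt_A2R, u1, ha2m, ne_eq, EmbeddingLike.apply_eq_iff_eq, not_false_eq_true, hlm, hler, and_self]
    · simp [u1, u2, ha2r, ha2m]
  have h3 := runs_alg2 h (N := X) (α := α) (m := m) (r := m) hXodd hX1 hn4 hαX hm1 hmN hm1 hmN hmX hnr T hI hCI u2 hw hsched hhist hbg hkn' hbf
    (by simp [u2, hbla]) (by simp [u2]) (by simp [u2]) (by simp [u2, hblpow]) (by simp [u2, ha2d]) (by simp [u2, ha2u]) (by simp [u2, ha2al]) (by simp [u2, ha2s]) (by simp [u2, ha2jj])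
    (by simp [u2, ha2c]) (by simp [u2, ha2am]) (by simp [u2, ha2p]) (by simp [u2, ha2q]) (by simp [u2, ha2t]) (by simp [u2, ha2j]) (by simp [u2, ha2v]) (by simp [u2, ha2a]) (by simp [u2, ha2b])
    (by simp [u2, ha2l1]) (by simp [u2, ha2l2]) (by simp [u2, ha2srt]) (by simp [u2, hl4]) (by simp [u2, hx1]) (by simp [u2, hx2]) (by simp [u2, hx3]) (by simp [u2, hx4]) (by simp [u2, hx5])
    (by simp [u2, hx6]) (by simp [u2, hfl1]) (by simp [u2, hfl2]) (by simp [u2, hu1]) (by simp [u2, hu2]) (by simp [u2, hsq1]) (by simp [u2, hsq2]) (by simp [u2, hsq3]) (by simp [u2, hsq4])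
    (by simp [u2, hsq5]) (by simp [u2, hrx1]) (by simp [u2, hrx2]) (by simp [u2, hrx3]) (by simp [u2, hrx4]) (by simp [u2, hrx5]) (by simp [u2, hrx6]) (by simp [u2, hrx7]) (by simp [u2, hrx8])
    (by simp [u2, hrx9]) (by simp [u2, hsfk]) (by simp [u2, hsfe]) (by simp [u2, hsfcand]) (by simp [u2, hsfbeta]) (by simp [u2, hsfdivs]) (by simp [u2, hsfr]) (by simp [u2, hsft])
    (by simp [u2, ha1c]) (by simp [u2, hblm]) (by simp [u2, ha1v]) (by simp [u2, ha1p]) (by simp [u2, hblk]) (by simp [u2, hl1]) (by simp [u2, hptk]) (by simp [u2, hptu]) (by simp [u2, hblf])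
    (by simp [u2, hble]) (by simp [u2, hblc1]) (by simp [u2, hblc2]) (by simp [u2, hblout]) (by simp [u2, ha1i]) (by simp [u2, ha1ai]) (by simp [u2, ha1g]) (by simp [u2, hblg]) (by simp [u2, hblfp])
  set out := a2Out X α m m with hout0
  have hlout : (encOpt out).length ≤ n := by
    rcases hq : out with _ | g
    · simp [encOpt]
    · simp only [encOpt]
      exact (Brick.length_encodeNat_mono (a2Out_le hX1 (hout0 ▸ hq))).trans hlN
  have hflag : (flagOpt out).length ≤ n := by
    rcases out with _ | _ <;> simp [flagOpt]
    all_goals omega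
  have h4 : Runs ((NS.ofList [.move (h .A2P) (h .MNP), .clear (h .A2Q), .clear (h .BLA), .clear (h .A2Y), .clear (h .A2R)] : NS β).com) (base (hSt h T { u2 with a2p := encOpt out, a2q := flagOpt out }))
      (base (hSt h T { u with bla := [], a2m := [], mnp := encOpt out })) (20 * c) := by
    refine NS.runs_of_eq (N := n) _ _ ?_ ?_ (by simp [hc3])
    · simp (config := { decide := true }) only [NS.ofList, NS.ok, NOp.ok, NS.eval, NOp.eval, hSt_A2P, hSt_MNP, hSt_A2Q, hSt_BLA, hSt_A2Y, hSt_A2R, update_hSt_A2P, update_hSt_MNP, update_hSt_A2Q, update_hSt_BLA,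
        update_hSt_A2Y, u2, hmnp, hbla, ne_eq, EmbeddingLike.apply_eq_iff_eq, not_false_eq_true, hlout, hflag, hlα, hlm, and_self]
    · simp [u2, hmnp, ha2p, ha2q, ha2y, ha2r]
  refine (h1.seq (h2.seq (h3.seq h4))).of_eq rfl ?_
  have : n * (16 * er + 21) + 3 * er + 7 ≤ n * (16 * n + 21) + 3 * n + 7 := by
    have := Nat.mul_le_mul_left n (show 16 * er + 21 ≤ 16 * n + 21 by omega); omega
  simp only [a2CallCost, ← hc3, hm0]; omega

/-- **Stage 5.** [folklore] -/
theorem runs_stage5 {X n α er : ℕ} (hXodd : Odd X) (hX1 : 1 < X) (hn4 : 4 * (encodeNat X).length + 20 ≤ n) (hnX : 10 ≤ (encodeNat X).length) (her : er = cER (encodeNat X).length)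
    (hαX : α < X) (fac : Option ℕ) (hfac : ∀ g, fac = some g → 1 ≤ g ∧ g ≤ X) (code2 : Bool)
    (T : Regs β) (hI : DrvInv (rGH h) X T) (hCI : T (h (.g .CINV)) = encodeNat (NegFFT.inv2N X))
    (u : HSlots) (hw : u.gw.Clean) (hsched : u.gw.sched = []) (hhist : u.gw.hist = []) (hbg : u.gw.bg = []) (hkn' : u.gw.kn = []) (hbf : u.gw.bf = [])
    (hblpow : u.blpow = encodeNat 2) (ha2y : u.a2y = []) (ha2r : u.a2r = [])
    (ha2d : u.a2d = []) (ha2u : u.a2u = []) (ha2al : u.a2al = []) (ha2s : u.a2s = []) (ha2jj : u.a2jj = []) (ha2c : u.a2c = []) (ha2am : u.a2am = [])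
    (ha2p : u.a2p = []) (ha2q : u.a2q = []) (ha2t : u.a2t = []) (ha2j : u.a2j = []) (ha2v : u.a2v = []) (ha2a : u.a2a = []) (ha2b : u.a2b = [])
    (ha2l1 : u.a2l1 = []) (ha2l2 : u.a2l2 = []) (ha2srt : u.a2srt = []) (hl4 : u.l4 = [])
    (hx1 : u.x1 = []) (hx2 : u.x2 = []) (hx3 : u.x3 = []) (hx4 : u.x4 = []) (hx5 : u.x5 = []) (hx6 : u.x6 = []) (hfl1 : u.fl1 = []) (hfl2 : u.fl2 = [])
    (hu1 : u.u1 = []) (hu2 : u.u2 = []) (hsq1 : u.sq1 = []) (hsq2 : u.sq2 = []) (hsq3 : u.sq3 = []) (hsq4 : u.sq4 = []) (hsq5 : u.sq5 = [])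
    (hrx1 : u.rx1 = []) (hrx2 : u.rx2 = []) (hrx3 : u.rx3 = []) (hrx4 : u.rx4 = []) (hrx5 : u.rx5 = []) (hrx6 : u.rx6 = []) (hrx7 : u.rx7 = []) (hrx8 : u.rx8 = []) (hrx9 : u.rx9 = [])
    (hsfk : u.sfk = []) (hsfe : u.sfe = []) (hsfcand : u.sfcand = []) (hsfbeta : u.sfbeta = []) (hsfdivs : u.sfdivs = []) (hsfr : u.sfr = []) (hsft : u.sft = [])
    (ha1c : u.a1c = []) (hblm : u.blm = []) (ha1v : u.a1v = []) (ha1p : u.a1p = []) (hblk : u.blk = []) (hl1 : u.l1 = [])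
    (hptk : u.ptk = []) (hptu : u.ptu = []) (hblf : u.blf = []) (hble : u.ble = []) (hblc1 : u.blc1 = []) (hblc2 : u.blc2 = []) (hblout : u.blout = [])
    (ha1i : u.a1i = []) (ha1ai : u.a1ai = []) (ha1g : u.a1g = []) (hblg : u.blg = []) (hblfp : u.blfp = []) (hbla : u.bla = []) (ha2m : u.a2m = []) :
    Runs (stage5 h) (base (hSt h T { u with mnp := encOpt fac, bla := encodeNat α, fl2 := flag code2, a2m := encodeNat er }))
      (base (hSt h T { u with mnp := encOpt (fac.or (if code2 then a2Out X α (2 ^ er) (2 ^ er) else none)) })) (stage5Cost n X α (2 ^ er)) := by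
  set c := (n + 1) ^ 3 with hc3
  have hlN : (encodeNat X).length ≤ n := by omega
  have hlα : (encodeNat α).length ≤ n := (Brick.length_encodeNat_mono hαX.le).trans hlN
  have hler : (encodeNat er).length ≤ n := (length_encodeNat_le_self _).trans (by rw [her, cER]; omega)
  let u0 : HSlots := { u with mnp := encOpt fac, bla := encodeNat α, fl2 := flag code2, a2m := encodeNat er }
  rcases fac with _ | g
  · -- no factor yet
    cases code2 with
    | true =>
      have hcall := runs_a2Call h hXodd hX1 hn4 hnX her hαX T hI hCI { u with mnp := encOpt (none : Option ℕ), bla := encodeNat α, fl2 := [], a2m := encodeNat er } hw hsched hhist hbg hkn' hbf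
        (by simp) (by simp) (by simp [hblpow]) (by simp [encOpt]) (by simp [ha2y]) (by simp [ha2r]) (by simp [ha2d]) (by simp [ha2u]) (by simp [ha2al]) (by simp [ha2s]) (by simp [ha2jj])
        (by simp [ha2c]) (by simp [ha2am]) (by simp [ha2p]) (by simp [ha2q]) (by simp [ha2t]) (by simp [ha2j]) (by simp [ha2v]) (by simp [ha2a]) (by simp [ha2b]) (by simp [ha2l1]) (by simp [ha2l2])
        (by simp [ha2srt]) (by simp [hl4]) (by simp [hx1]) (by simp [hx2]) (by simp [hx3]) (by simp [hx4]) (by simp [hx5]) (by simp [hx6]) (by simp [hfl1]) (by simp) (by simp [hu1]) (by simp [hu2])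
        (by simp [hsq1]) (by simp [hsq2]) (by simp [hsq3]) (by simp [hsq4]) (by simp [hsq5]) (by simp [hrx1]) (by simp [hrx2]) (by simp [hrx3]) (by simp [hrx4]) (by simp [hrx5]) (by simp [hrx6])
        (by simp [hrx7]) (by simp [hrx8]) (by simp [hrx9]) (by simp [hsfk]) (by simp [hsfe]) (by simp [hsfcand]) (by simp [hsfbeta]) (by simp [hsfdivs]) (by simp [hsfr]) (by simp [hsft])
        (by simp [ha1c]) (by simp [hblm]) (by simp [ha1v]) (by simp [ha1p]) (by simp [hblk]) (by simp [hl1]) (by simp [hptk]) (by simp [hptu]) (by simp [hblf]) (by simp [hble]) (by simp [hblc1])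
        (by simp [hblc2]) (by simp [hblout]) (by simp [ha1i]) (by simp [ha1ai]) (by simp [ha1g]) (by simp [hblg]) (by simp [hblfp])
      have hpop := Runs.opop_true (k := h .FL2) (ct := a2Call h) skip ((NS.ofList [.clear (h .BLA), .clear (h .A2M)] : NS β).com) (T := hSt h T u0) (w := []) (by simp [u0, flag])
        (by rw [update_hSt_FL2]; exact hcall)
      refine (runs_whenCons_nil h .MNP _ (hSt h T u0) (by simp [u0, encOpt]) hpop).of_eq ?_ ?_
      · simp [hbla, ha2m, hfl2]
      · simp only [stage5Cost]; omega
    | false =>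
      have hB : Runs ((NS.ofList [.clear (h .BLA), .clear (h .A2M)] : NS β).com) (base (hSt h T u0)) (base (hSt h T { u with mnp := encOpt ((none : Option ℕ).or (if false then a2Out X α (2 ^ er) (2 ^ er) else none)) })) (6 * c) := by
        refine NS.runs_of_eq (N := n) _ _ ?_ ?_ (by simp [hc3])
        · simp only [NS.ofList, NS.ok, NOp.ok, NS.eval, NOp.eval, hSt_BLA, hSt_A2M, update_hSt_BLA, u0]; exact ⟨hlα, hler, trivial⟩
        · simp [u0, hbla, ha2m, hfl2, flag, encOpt]
      have hpop := Runs.opop_nil (k := h .FL2) (a2Call h) skip (T := hSt h T u0) (by simp [u0, flag]) hB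
      refine (runs_whenCons_nil h .MNP _ (hSt h T u0) (by simp [u0, encOpt]) hpop).of_eq rfl ?_
      have : 1 ≤ a2CallCost n X α (2 ^ er) := by unfold a2CallCost; omega
      simp only [stage5Cost, ← hc3]; omega
  · -- a factor is known: clean-up only
    obtain ⟨hg1, hgX⟩ := hfac g rfl
    have hlg : (encodeNat g).length ≤ n := (Brick.length_encodeNat_mono hgX).trans hlN
    obtain ⟨bb, w, hbw⟩ := encodeNat_eq_cons (show 0 < g by omega)
    have hflag : (flag code2).length ≤ n := by
      cases code2 <;> simp [flag]
      all_goals omega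
    have hB : Runs ((NS.ofList [.clear (h .FL2), .clear (h .BLA), .clear (h .A2M)] : NS β).com) (base (hSt h T u0)) (base (hSt h T { u with mnp := encOpt ((some g).or (if code2 then a2Out X α (2 ^ er) (2 ^ er) else none)) })) (9 * c) := by
      refine NS.runs_of_eq (N := n) _ _ ?_ ?_ (by simp [hc3])
      · simp only [NS.ofList, NS.ok, NOp.ok, NS.eval, NOp.eval, hSt_FL2, hSt_BLA, hSt_A2M, update_hSt_FL2, update_hSt_BLA, u0]; exact ⟨hflag, hlα, hler, trivial⟩
      · simp [u0, hbla, ha2m, hfl2, Option.some_or]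
    refine (runs_whenCons_cons h .MNP (Com.pop (Sum.inr (h .FL2)) (a2Call h) skip ((NS.ofList [.clear (h .BLA), .clear (h .A2M)] : NS β).com)) (hSt h T u0) (bb := bb) (w := w)
      (by simp [u0, encOpt, hbw]) hB).of_eq rfl ?_
    have : 1 ≤ a2CallCost n X α (2 ^ er) := by unfold a2CallCost; omega
    simp only [stage5Cost, ← hc3]; omega

/-- The lengths of the parameters of the order search. [folklore] -/
theorem stage4Params_facts {X n : ℕ} (hX1 : 1 < X) (hn : 2 * (encodeNat X).length + 8 ≤ n) :
    let nX := (encodeNat X).length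
    1 ≤ 2 ^ cL3 nX ∧ (encodeNat (2 ^ cL3 nX * 2 ^ (2 * cE3 nX))).length ≤ n ∧ (encodeNat (Nat.sqrt X + 1)).length ≤ n ∧ 2 * cE3 nX + 8 ≤ n ∧ cL3 nX + 2 ≤ n := by
  intro nX
  have hnX2 : 2 ≤ nX := by
    have h2 : (encodeNat 2).length = 2 := by rw [show (2 : ℕ) = 2 ^ 1 by norm_num, encodeNat_two_pow]; simp
    have := Brick.length_encodeNat_mono (show 2 ≤ X by omega); rw [h2] at this; exact this
  have h1 : cL3 nX ≤ nX / 2 + 2 := by simp only [cL3]; omega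
  have h2 : cE3 nX ≤ nX / 10 + 1 := by simp only [cE3]; omega
  refine ⟨Nat.one_le_two_pow, ?_, ?_, by omega, by omega⟩
  · rw [← pow_add, encodeNat_two_pow]; simp; omega
  · have hs : Nat.sqrt X + 1 ≤ X := by have := Nat.sqrt_lt_self hX1; omega
    exact (Brick.length_encodeNat_mono hs).trans (by omega)

/-- **Stages 4–5.** [folklore] -/
theorem runs_stage45 {X n B : ℕ} (hXodd : Odd X) (hX1 : 1 < X) (hn4 : 4 * (encodeNat X).length + 20 ≤ n) (hnX : 10 ≤ (encodeNat X).length)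
    (T : Regs β) (hI : DrvInv (rGH h) X T) (hCI : T (h (.g .CINV)) = encodeNat (NegFFT.inv2N X))
    (u : HSlots) (hw : u.gw.Clean) (hsched : u.gw.sched = []) (hhist : u.gw.hist = []) (hbg : u.gw.bg = []) (hkn' : u.gw.kn = []) (hbf : u.gw.bf = [])
    (hBX : B + 2 ≤ X) (hlB : (encodeNat B).length ≤ n) (hcop : ∀ a, 2 ≤ a → a ≤ B + 1 → Nat.Coprime a X)
    (hmn0 : u.mn0 = encodeNat X) (hmnb : u.mnb = encodeNat B) (hblpow : u.blpow = encodeNat 2) (hmnp : u.mnp = [])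
    (ha1p : u.a1p = []) (hsfbmax : u.sfbmax = []) (hsfm : u.sfm = []) (hsfb : u.sfb = []) (hbla : u.bla = []) (hsfl : u.sfl = []) (ha2m : u.a2m = []) (ha2y : u.a2y = []) (ha2r : u.a2r = [])
    (ha2d : u.a2d = []) (ha2u : u.a2u = []) (ha2al : u.a2al = []) (ha2s : u.a2s = []) (ha2jj : u.a2jj = []) (ha2c : u.a2c = []) (ha2am : u.a2am = [])
    (ha2p : u.a2p = []) (ha2q : u.a2q = []) (ha2t : u.a2t = []) (ha2j : u.a2j = []) (ha2v : u.a2v = []) (ha2a : u.a2a = []) (ha2b : u.a2b = [])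
    (ha2l1 : u.a2l1 = []) (ha2l2 : u.a2l2 = []) (ha2srt : u.a2srt = []) (hl4 : u.l4 = [])
    (hx1 : u.x1 = []) (hx2 : u.x2 = []) (hx3 : u.x3 = []) (hx4 : u.x4 = []) (hx5 : u.x5 = []) (hx6 : u.x6 = []) (hfl1 : u.fl1 = []) (hfl2 : u.fl2 = [])
    (hu1 : u.u1 = []) (hu2 : u.u2 = []) (hsq1 : u.sq1 = []) (hsq2 : u.sq2 = []) (hsq3 : u.sq3 = []) (hsq4 : u.sq4 = []) (hsq5 : u.sq5 = [])
    (hrx1 : u.rx1 = []) (hrx2 : u.rx2 = []) (hrx3 : u.rx3 = []) (hrx4 : u.rx4 = []) (hrx5 : u.rx5 = []) (hrx6 : u.rx6 = []) (hrx7 : u.rx7 = []) (hrx8 : u.rx8 = []) (hrx9 : u.rx9 = [])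
    (hsfk : u.sfk = []) (hsfe : u.sfe = []) (hsfcand : u.sfcand = []) (hsfbeta : u.sfbeta = []) (hsfdivs : u.sfdivs = []) (hsfr : u.sfr = []) (hsft : u.sft = []) (hsfd : u.sfd = [])
    (ha1c : u.a1c = []) (hblm : u.blm = []) (ha1v : u.a1v = []) (hblk : u.blk = []) (hl1 : u.l1 = []) (hl2 : u.l2 = [])
    (hptk : u.ptk = []) (hptu : u.ptu = []) (hblf : u.blf = []) (hble : u.ble = []) (hblc1 : u.blc1 = []) (hblc2 : u.blc2 = []) (hblout : u.blout = [])
    (ha1i : u.a1i = []) (ha1ai : u.a1ai = []) (ha1g : u.a1g = []) (hblg : u.blg = []) (hblfp : u.blfp = []) :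
    Runs (stage45 h) (base (hSt h T u)) (base (hSt h T { u with mnp := encOpt (stage45Out X B) })) (stage45Cost n X B) := by
  set nX := (encodeNat X).length with hnX0
  have hn : (encodeNat X).length + 1 ≤ n := by omega
  obtain ⟨hLB1, hlLBn, hlM1, hen, hcl⟩ := stage4Params_facts (X := X) (n := n) hX1 (by omega)
  rw [← hnX0] at hlLBn hen hcl
  have h1 := runs_c4Par h (N := X) (X := X) (B := B) hn (by omega) le_rfl hlB (by rw [← hnX0]; exact hcl) T hI u hmn0 hmnb ha1p hsfbmax hsfm hsfb ha2m hx2 hx3 hx4 hx5 hx6 hsq1 hsq2 hsq3 hsq4 hsq5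
  rw [← hnX0] at h1
  let u' : HSlots := { u with a2m := encodeNat (cER nX) }
  change Runs (c4Par h) _ (base (hSt h T { u' with a1p := encodeNat (cE3 nX), sfbmax := encodeNat (2 ^ cL3 nX), sfm := encodeNat (Nat.sqrt X), sfb := encodeNat B })) _ at h1
  have h2 := runs_sfCallB h (N := X) (e := cE3 nX) (LB := 2 ^ cL3 nX) (M := Nat.sqrt X) (B := B) hXodd hX1 hn hen T hI hCI u' hw hsched hhist hbg hkn' hbf hLB1 hlLBn hlM1 hBX hlB hcop
    (by simp [u', hblpow]) (by simp [u', hmnp]) (by simp [u', hbla]) (by simp [u', hsfl]) (by simp [u', hu2]) (by simp [u', hl1]) (by simp [u', hx1]) (by simp [u', hx2]) (by simp [u', hx3]) (by simp [u', hx4])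
    (by simp [u', hx5]) (by simp [u', hx6]) (by simp [u', hfl1]) (by simp [u', hfl2]) (by simp [u', hl2]) (by simp [u', hu1]) (by simp [u', hl4]) (by simp [u', hptk]) (by simp [u', hptu]) (by simp [u', hblf])
    (by simp [u', hble]) (by simp [u', hblc1]) (by simp [u', hblc2]) (by simp [u', hblout]) (by simp [u', ha1i]) (by simp [u', ha1ai]) (by simp [u', ha1g]) (by simp [u', hblg]) (by simp [u', hblfp])
    (by simp [u', ha1v]) (by simp [u', ha1c]) (by simp [u', hblm]) (by simp [u', hblk]) (by simp [u', hsfe]) (by simp [u', hsfk]) (by simp [u', hsft]) (by simp [u', hsfr]) (by simp [u', hsfbeta]) (by simp [u', hsfcand])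
    (by simp [u', hsfdivs]) (by simp [u', hsfd])
  set st := sfRun X (cE3 nX) (2 ^ cL3 nX) (Nat.sqrt X) B with hst0
  have hstE : st = stage4St X B := by simp only [hst0, stage4St, hnX0]
  obtain ⟨hα, -, -, -, hfac⟩ := sfRun_outcome_facts (e := cE3 nX) (LB := 2 ^ cL3 nX) (M := Nat.sqrt X) (B := B) hXodd hX1 hLB1 hcop
  rw [← hst0] at hα hfac
  have hαX : st.1 < X := by omega
  have h2' := h2.of_eq (R' := base (hSt h T { u with mnp := encOpt (sfFac st), bla := encodeNat st.1, fl2 := flag (decide (sfCode st = 2)), a2m := encodeNat (cER nX) })) (by simp [u', ha1p, hsfbmax, hsfm, hsfb]) le_rfl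
  have h3 := runs_stage5 h (er := cER nX) hXodd hX1 hn4 hnX rfl hαX (sfFac st) (fun g hg => ⟨by have := (hfac g hg).1; omega, (hfac g hg).2.1.le⟩) (decide (sfCode st = 2)) T hI hCI u hw hsched hhist hbg hkn' hbf
    hblpow ha2y ha2r ha2d ha2u ha2al ha2s ha2jj ha2c ha2am ha2p ha2q ha2t ha2j ha2v ha2a ha2b ha2l1 ha2l2 ha2srt hl4 hx1 hx2 hx3 hx4 hx5 hx6 hfl1 hfl2 hu1 hu2 hsq1 hsq2 hsq3 hsq4 hsq5
    hrx1 hrx2 hrx3 hrx4 hrx5 hrx6 hrx7 hrx8 hrx9 hsfk hsfe hsfcand hsfbeta hsfdivs hsfr hsft ha1c hblm ha1v ha1p hblk hl1 hptk hptu hblf hble hblc1 hblc2 hblout ha1i ha1ai ha1g hblg hblfp hbla ha2m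
  refine (h1.seq (h2'.seq h3)).of_eq ?_ ?_
  · congr 2; simp only [stage45Out, ← hnX0, ← hstE]
    congr 2
    by_cases hc : sfCode st = 2 <;> simp [hc]
  · simp only [stage45Cost, ← hnX0, ← hstE]; exact le_rfl

/-- A stage guarded by "no factor yet". [folklore] -/
def gd (S : Com (EReg ⊕ β)) : Com (EReg ⊕ β) := whenCons h .MNP skip S

/-- **The per-number procedure**: the four stages, each run only while no factor is known. [folklore] -/
def core : Com (EReg ⊕ β) := stage1 h ;; (gd h (stage2 h) ;; (gd h (stage3 h) ;; gd h (stage45 h)))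

/-- **The outcome of the per-number procedure**: a factor from one of the stages (in order), or none ("`X` is prime"). [folklore] -/
def coreOut (X B : ℕ) : Option ℕ := (((stage1Out X B).or (sqFac X)).or (stage3Out X B)).or (stage45Out X B)

/-- Cost of the per-number procedure. [folklore] -/
def coreCost (n X B : ℕ) : ℕ :=
  let nX := (encodeNat X).length
  stage1Cost n nX B + ((stage2Cost n + 3) + ((stage3Cost n nX B + 3) + (stage45Cost n X B + 3)))

/-- **A guarded stage.** [folklore] -/
theorem runs_gd {S : Com (EReg ⊕ β)} {T : Regs β} {u : HSlots} (o out : Option ℕ) {C : ℕ} (ho : ∀ g, o = some g → 1 ≤ g)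
    (hS : o = none → Runs S (base (hSt h T { u with mnp := encOpt o })) (base (hSt h T { u with mnp := encOpt out })) C) :
    Runs (gd h S) (base (hSt h T { u with mnp := encOpt o })) (base (hSt h T { u with mnp := encOpt (o.or out) })) (C + 3) := by
  rcases o with _ | g
  · exact (runs_whenCons_nil h .MNP skip (hSt h T { u with mnp := encOpt (none : Option ℕ) }) (by simp [encOpt]) (hS rfl)).of_eq (by simp) (by omega)
  · obtain ⟨bb, w, hbw⟩ := encodeNat_eq_cons (show 0 < g from ho g rfl)
    exact (runs_whenCons_cons h .MNP S (hSt h T { u with mnp := encOpt (some g) }) (bb := bb) (w := w) (by simp [encOpt, hbw]) (Runs.skip _)).of_eq (by simp) (by omega)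

/-- The factors reported by the stages are `≥ 1` (indeed `> 1`, resp. `⌊√X⌋ ≥ 1`). [folklore] -/
theorem stageOuts_pos {X B : ℕ} (hXodd : Odd X) (hX1 : 1 < X) (hcop : ∀ a, 2 ≤ a → a ≤ B + 1 → Nat.Coprime a X) :
    (∀ g, stage1Out X B = some g → 1 ≤ g) ∧ (∀ g, sqFac X = some g → 1 ≤ g) ∧ (∀ g, stage3Out X B = some g → 1 ≤ g) := by
  refine ⟨fun g hg => ?_, fun g hg => ?_, fun g hg => ?_⟩
  · have := (sfRun_outcome_facts (e := cE1 (encodeNat X).length) (LB := 2 ^ cE1 (encodeNat X).length) (M := 2 ^ cE1 (encodeNat X).length * 2 ^ cE1 (encodeNat X).length) (B := B)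
      hXodd hX1 Nat.one_le_two_pow hcop).2.2.2.2 g hg
    omega
  · unfold sqFac at hg; split_ifs at hg with hs
    obtain rfl := Option.some.inj hg
    rw [Nat.succ_le_iff, Nat.sqrt_pos]; omega
  · have := (sfRun_outcome_facts (e := cE2 (encodeNat X).length) (LB := 2 ^ cE2 (encodeNat X).length) (M := 2 ^ cE2 (encodeNat X).length * 2 ^ cE2 (encodeNat X).length) (B := B)
      hXodd hX1 Nat.one_le_two_pow hcop).2.2.2.2 g hg
    omega

/-- **The per-number procedure on the machine.** [folklore] -/
theorem runs_core {X n B : ℕ} (hXodd : Odd X) (hX1 : 1 < X) (hn4 : 4 * (encodeNat X).length + 20 ≤ n) (hnX : 10 ≤ (encodeNat X).length)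
    (T : Regs β) (hI : DrvInv (rGH h) X T) (hCI : T (h (.g .CINV)) = encodeNat (NegFFT.inv2N X))
    (u : HSlots) (hw : u.gw.Clean) (hsched : u.gw.sched = []) (hhist : u.gw.hist = []) (hbg : u.gw.bg = []) (hkn' : u.gw.kn = []) (hbf : u.gw.bf = [])
    (hBX : B + 2 ≤ X) (hlB : (encodeNat B).length ≤ n) (hcop : ∀ a, 2 ≤ a → a ≤ B + 1 → Nat.Coprime a X)
    (hmn0 : u.mn0 = encodeNat X) (hmnb : u.mnb = encodeNat B) (hblpow : u.blpow = encodeNat 2) (hmnp : u.mnp = [])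
    (ha1p : u.a1p = []) (hsfbmax : u.sfbmax = []) (hsfm : u.sfm = []) (hsfb : u.sfb = []) (hbla : u.bla = []) (hsfl : u.sfl = []) (ha2m : u.a2m = []) (ha2y : u.a2y = []) (ha2r : u.a2r = [])
    (ha2d : u.a2d = []) (ha2u : u.a2u = []) (ha2al : u.a2al = []) (ha2s : u.a2s = []) (ha2jj : u.a2jj = []) (ha2c : u.a2c = []) (ha2am : u.a2am = [])
    (ha2p : u.a2p = []) (ha2q : u.a2q = []) (ha2t : u.a2t = []) (ha2j : u.a2j = []) (ha2v : u.a2v = []) (ha2a : u.a2a = []) (ha2b : u.a2b = [])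
    (ha2l1 : u.a2l1 = []) (ha2l2 : u.a2l2 = []) (ha2srt : u.a2srt = []) (hl4 : u.l4 = [])
    (hx1 : u.x1 = []) (hx2 : u.x2 = []) (hx3 : u.x3 = []) (hx4 : u.x4 = []) (hx5 : u.x5 = []) (hx6 : u.x6 = []) (hfl1 : u.fl1 = []) (hfl2 : u.fl2 = [])
    (hu1 : u.u1 = []) (hu2 : u.u2 = []) (hsq1 : u.sq1 = []) (hsq2 : u.sq2 = []) (hsq3 : u.sq3 = []) (hsq4 : u.sq4 = []) (hsq5 : u.sq5 = [])
    (hrx1 : u.rx1 = []) (hrx2 : u.rx2 = []) (hrx3 : u.rx3 = []) (hrx4 : u.rx4 = []) (hrx5 : u.rx5 = []) (hrx6 : u.rx6 = []) (hrx7 : u.rx7 = []) (hrx8 : u.rx8 = []) (hrx9 : u.rx9 = [])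
    (hsfk : u.sfk = []) (hsfe : u.sfe = []) (hsfcand : u.sfcand = []) (hsfbeta : u.sfbeta = []) (hsfdivs : u.sfdivs = []) (hsfr : u.sfr = []) (hsft : u.sft = []) (hsfd : u.sfd = [])
    (ha1c : u.a1c = []) (hblm : u.blm = []) (ha1v : u.a1v = []) (hblk : u.blk = []) (hl1 : u.l1 = []) (hl2 : u.l2 = [])
    (hptk : u.ptk = []) (hptu : u.ptu = []) (hblf : u.blf = []) (hble : u.ble = []) (hblc1 : u.blc1 = []) (hblc2 : u.blc2 = []) (hblout : u.blout = [])
    (ha1i : u.a1i = []) (ha1ai : u.a1ai = []) (ha1g : u.a1g = []) (hblg : u.blg = []) (hblfp : u.blfp = []) :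
    Runs (core h) (base (hSt h T u)) (base (hSt h T { u with mnp := encOpt (coreOut X B) })) (coreCost n X B) := by
  have hn : (encodeNat X).length + 1 ≤ n := by omega
  obtain ⟨hp1, hp2, hp3⟩ := stageOuts_pos (B := B) hXodd hX1 hcop
  have h1 := runs_stage1 h hXodd hX1 hn (by omega) T hI hCI u hw hsched hhist hbg hkn' hbf hBX hlB hcop hmn0 hmnb hblpow hmnp ha1p hsfbmax hsfm hsfb hbla hsfl hu2 hl1 hx1 hx2 hx3 hx4 hx5 hx6 hfl1 hfl2 hl2 hu1 hl4
    hptk hptu hblf hble hblc1 hblc2 hblout ha1i ha1ai ha1g hblg hblfp ha1v ha1c hblm hblk hsfe hsfk hsft hsfr hsfbeta hsfcand hsfdivs hsfd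
  have hU : ∀ o : Option ℕ, o = none → ({ u with mnp := encOpt o } : HSlots) = u := by
    rintro o rfl; cases u; simp only [encOpt] at *; subst hmnp; rfl
  have h2 := runs_gd h (S := stage2 h) (T := T) (u := u) (stage1Out X B) (sqFac X) hp1 (fun ho => by
    rw [hU _ ho]; exact runs_stage2 h hn T u hmn0 hmnp hx2 hx3 hx6 hfl2 hsq1 hsq2 hsq3 hsq4 hsq5)
  have h3 := runs_gd h (S := stage3 h) (T := T) (u := u) ((stage1Out X B).or (sqFac X)) (stage3Out X B)
    (fun g hg => by rcases Option.or_eq_some_iff.1 hg with hg | ⟨-, hg⟩; exacts [hp1 g hg, hp2 g hg]) (fun ho => by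
    rw [hU _ ho]
    exact runs_stage3 h hXodd hX1 hn (by omega) T hI hCI u hw hsched hhist hbg hkn' hbf hBX hlB hcop hmn0 hmnb hblpow hmnp ha1p hsfbmax hsfm hsfb hbla hsfl hu2 hl1 hx1 hx2 hx3 hx4 hx5 hx6 hfl1 hfl2 hl2 hu1 hl4
      hptk hptu hblf hble hblc1 hblc2 hblout ha1i ha1ai ha1g hblg hblfp ha1v ha1c hblm hblk hsfe hsfk hsft hsfr hsfbeta hsfcand hsfdivs hsfd)
  have h4 := runs_gd h (S := stage45 h) (T := T) (u := u) (((stage1Out X B).or (sqFac X)).or (stage3Out X B)) (stage45Out X B)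
    (fun g hg => by
      rcases Option.or_eq_some_iff.1 hg with hg | ⟨-, hg⟩
      · rcases Option.or_eq_some_iff.1 hg with hg | ⟨-, hg⟩; exacts [hp1 g hg, hp2 g hg]
      · exact hp3 g hg) (fun ho => by
    rw [hU _ ho]
    exact runs_stage45 h hXodd hX1 hn4 hnX T hI hCI u hw hsched hhist hbg hkn' hbf hBX hlB hcop hmn0 hmnb hblpow hmnp ha1p hsfbmax hsfm hsfb hbla hsfl ha2m ha2y ha2r ha2d ha2u ha2al ha2s ha2jj ha2c ha2am
      ha2p ha2q ha2t ha2j ha2v ha2a ha2b ha2l1 ha2l2 ha2srt hl4 hx1 hx2 hx3 hx4 hx5 hx6 hfl1 hfl2 hu1 hu2 hsq1 hsq2 hsq3 hsq4 hsq5 hrx1 hrx2 hrx3 hrx4 hrx5 hrx6 hrx7 hrx8 hrx9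
      hsfk hsfe hsfcand hsfbeta hsfdivs hsfr hsft hsfd ha1c hblm ha1v hblk hl1 hl2 hptk hptu hblf hble hblc1 hblc2 hblout ha1i ha1ai ha1g hblg hblfp)
  exact (h1.seq (h2.seq (h3.seq h4))).of_eq (by simp only [coreOut]) (by simp only [coreCost]; omega)

end CoreAssembly

end Com

end Literature.Computability.Complexity
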